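import Literature.Probability.Percolation.RhombicTilingEdgeToEdge
import HarnessLib

/-!
# Planarity of rhombic tilings: strips, de Bruijn's ribbons, and corner consistency

Umbrella file (parts VI–VIII of the planarity series). **Main theorem** (`cornerConsistent`,
`z_ne_c_leftFace`): for a preconnected graph `G` isoradially embedded with the tiling condition
and bounded angles, **no vertex of `G` is drawn at the centre of a face of a rhombus**,
`emb.z v ≠ emb.c (emb.leftFace d)` — the corners of the diamond graph `G^◇` are properly
two-coloured "vertex of `G`" / "vertex of `G*`" (Grimmett–Manolescu 2014, §2.1, §4.1;
Kenyon–Schlenker 2005), the hypothesis `hcons`/`hclash` of the planar-duality files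
`IsoradialDualCrossings` / `IsoradialDualityExclusion`. Parts: VI the geometry of a strip
(`StripData`, the continuous longitudinal coordinate `StripData.a`); VII de Bruijn's ribbons
(`Ribbon.perm`, `Ribbon.seq`, `Ribbon.stripData`: every ribbon is a strip; the rhombus across a
lateral side of a rhombus of a ribbon is not on it); VIII the parity colouring (`Parity.chi`,
`Parity.chi_flip`) and the main theorem. The three parts keep their own module docstrings below.
-/

/-!
# Planarity of rhombic tilings, VI: strips (the geometry of a de Bruijn ribbon)

Topic `Literature/Probability/Percolation`. Pure plane geometry, independent of graphs: the
shape of a *ribbon* (train track) of a rhombic tiling. A ribbon is a bi-infinite chain of unit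
rhombi in which consecutive rhombi share a side, all shared sides being translates of one unit
vector `w` (de Bruijn 1981, §4; Grimmett–Manolescu 2014, §4.2: "a track is a doubly infinite
sequence of rhombi, each sharing a side with the next, such that the shared sides of any rhombus
are opposite"; Kenyon–Schlenker 2005, §3). Abstractly (`StripData`): a unit vector `w`, lower
corners `L n`, `n ∈ ℤ`, with unit steps `‖L (n+1) - L n‖ = 1`, the `n`-th rhombus being the
parallelogram `conv{L n, L n + w, L (n+1) + w, L (n+1)}` (`hull n`), and the transversal
coordinate `t = Im((· - L 0) w̄)` increasing by at least `η > 0` at each step (bounded angles).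

Results (all [folklore] plane geometry, used by the parity argument of the sequel):
* `idx`, `tn_idx_le`, `lt_tn_idx_succ` — the slab `t ∈ [tₙ, tₙ₊₁)` containing a given height;
* `a` — **the longitudinal coordinate**, a continuous function on the plane (`continuous_a`)
  equal on the `n`-th slab to the oblique coordinate along `w` of the `n`-th rhombus
  (`a_eq_alpha`), with `a (L n) = 0`, `a (L n + w) = 1`;
* `hull_subset`, `mem_hull_idx` — the union of the rhombi (the *strip*) is `{0 ≤ a ≤ 1}`;
* `subset_or_subset` — **a convex body whose interior misses every rhombus of the strip lies on
  one side**, `{a ≤ 0}` or `{1 ≤ a}`;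
* `exists_mem_segment` — **a segment from one side to the other meets the strip**.

## References

* N. G. de Bruijn, *Algebraic theory of Penrose's non-periodic tilings of the plane*, Indag.
  Math. 43 (1981), §4 (the "ribbons" of a rhombic tiling).
* G. R. Grimmett, I. Manolescu, *Bond percolation on isoradial graphs*, PTRF 159 (2014),
  arXiv:1204.0505, §4.2 (track systems).
* R. Kenyon, J.-M. Schlenker, *Rhombic embeddings of planar quad-graphs*, TAMS 357 (2005), §3.
-/

noncomputable section

open Complex ComplexConjugate Metric Set Filter Topology

namespace Literature.Probability.Percolation

/-- **The data of a strip** (the shape of a de Bruijn ribbon): a unit vector `w` (direction of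
the shared sides), lower corners `L n` with unit steps, and a gap `η > 0` by which the
transversal coordinate `Im((L n - L 0) w̄)` increases at each step.
[cite: Bruijn1981, §4 (ribbons of a rhombic tiling)] -/
structure StripData where
  /-- Direction of the shared sides. -/
  w : ℂ
  /-- Lower corners of the shared sides. -/
  L : ℤ → ℂ
  /-- Minimal transversal step. -/
  η : ℝ
  norm_w : ‖w‖ = 1
  norm_step : ∀ n, ‖L (n + 1) - L n‖ = 1
  η_pos : 0 < η
  gap : ∀ n, ((L n - L 0) * (starRingEnd ℂ) w).im + η ≤ ((L (n + 1) - L 0) * (starRingEnd ℂ) w).im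

namespace StripData

variable (D : StripData)

/-! ### The transversal coordinate and the slabs -/

/-- The transversal coordinate `t Y = Im((Y - L 0) w̄)` (signed distance to the line of the
`0`-th shared side). [folklore] -/
def t (Y : ℂ) : ℝ := sideFn (D.L 0) (D.L 0 + D.w) Y

/-- The heights `tₙ = t (L n)` of the shared sides. [folklore] -/
def tn (n : ℤ) : ℝ := D.t (D.L n)

/-- The transversal coordinate, expanded. [folklore] -/
theorem t_def (Y : ℂ) : D.t Y = ((Y - D.L 0) * conj D.w).im := by
  simp [t, sideFn]

/-- The transversal coordinate is continuous. [folklore] -/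
theorem continuous_t : Continuous D.t := continuous_sideFn _ _

/-- `t` is unchanged along `w`. [folklore] -/
theorem t_add_real_mul_w (Y : ℂ) (c : ℝ) : D.t (Y + (c : ℂ) * D.w) = D.t Y := by
  rw [t, sideFn_add_smul, add_sub_cancel_left, Complex.mul_conj, Complex.ofReal_im, mul_zero,
    add_zero]
  rfl

/-- `t` is `1`-Lipschitz: `|t Y - t Y'| ≤ ‖Y - Y'‖`. [folklore] -/
theorem abs_t_sub_t_le (Y Y' : ℂ) : |D.t Y - D.t Y'| ≤ ‖Y - Y'‖ := by
  rw [t_def, t_def, ← Complex.sub_im]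
  have : (Y - D.L 0) * conj D.w - (Y' - D.L 0) * conj D.w = (Y - Y') * conj D.w := by ring
  rw [this]
  calc |((Y - Y') * conj D.w).im| ≤ ‖(Y - Y') * conj D.w‖ := Complex.abs_im_le_norm _
    _ = ‖Y - Y'‖ := by rw [norm_mul, Complex.norm_conj, D.norm_w, mul_one]

/-- The gap: `tₙ + η ≤ tₙ₊₁`. [folklore] -/
theorem tn_add_η_le (n : ℤ) : D.tn n + D.η ≤ D.tn (n + 1) := by
  have := D.gap n
  simp only [tn, t_def]
  exact this

/-- The heights are strictly increasing. [folklore] -/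
theorem tn_strictMono : StrictMono D.tn := by
  apply strictMono_int_of_lt_succ
  intro n
  have := D.tn_add_η_le n
  linarith [D.η_pos]

/-- Linear growth upwards. [folklore] -/
theorem tn_add_nat_ge (n : ℤ) (k : ℕ) : D.tn n + k * D.η ≤ D.tn (n + k) := by
  induction k with
  | zero => simp
  | succ k ih =>
    have := D.tn_add_η_le (n + k)
    push_cast at this ⊢
    rw [← add_assoc]
    linarith

/-- Linear growth downwards. [folklore] -/
theorem tn_sub_nat_le (n : ℤ) (k : ℕ) : D.tn (n - k) ≤ D.tn n - k * D.η := by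
  have := D.tn_add_nat_ge (n - k) k
  rw [sub_add_cancel] at this
  linarith

/-- The heights are unbounded below. [folklore] -/
theorem exists_tn_le (τ : ℝ) : ∃ n, D.tn n ≤ τ := by
  obtain ⟨k, hk⟩ := Archimedean.arch (D.tn 0 - τ) D.η_pos
  refine ⟨0 - k, ?_⟩
  have := D.tn_sub_nat_le 0 k
  rw [nsmul_eq_mul] at hk
  linarith

/-- The heights are unbounded above. [folklore] -/
theorem exists_lt_tn (τ : ℝ) : ∃ n, τ < D.tn n := by
  obtain ⟨k, hk⟩ := Archimedean.arch (τ - D.tn 0 + 1) D.η_pos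
  refine ⟨0 + k, ?_⟩
  have := D.tn_add_nat_ge 0 k
  rw [nsmul_eq_mul] at hk
  linarith

/-- The index of the slab containing the height `τ`: the largest `n` with `tₙ ≤ τ`. [folklore] -/
def idx (τ : ℝ) : ℤ := sSup {n : ℤ | D.tn n ≤ τ}

/-- The set of indices below a height is nonempty. [folklore] -/
theorem idx_set_nonempty (τ : ℝ) : {n : ℤ | D.tn n ≤ τ}.Nonempty := D.exists_tn_le τ

/-- The set of indices below a height is bounded above. [folklore] -/
theorem idx_set_bddAbove (τ : ℝ) : BddAbove {n : ℤ | D.tn n ≤ τ} := by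
  obtain ⟨N, hN⟩ := D.exists_lt_tn τ
  refine ⟨N, fun n hn => ?_⟩
  have : D.tn n < D.tn N := lt_of_le_of_lt hn hN
  exact (D.tn_strictMono.lt_iff_lt.1 this).le

/-- `t_{idx τ} ≤ τ`. [folklore] -/
theorem tn_idx_le (τ : ℝ) : D.tn (D.idx τ) ≤ τ :=
  Int.csSup_mem (D.idx_set_nonempty τ) (D.idx_set_bddAbove τ)

/-- `τ < t_{idx τ + 1}`. [folklore] -/
theorem lt_tn_idx_succ (τ : ℝ) : τ < D.tn (D.idx τ + 1) := by
  by_contra h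
  push Not at h
  have : D.idx τ + 1 ≤ D.idx τ := le_csSup (D.idx_set_bddAbove τ) h
  linarith

/-- Characterisation of the index. [folklore] -/
theorem idx_eq_iff {τ : ℝ} {n : ℤ} : D.idx τ = n ↔ D.tn n ≤ τ ∧ τ < D.tn (n + 1) := by
  constructor
  · rintro rfl; exact ⟨D.tn_idx_le τ, D.lt_tn_idx_succ τ⟩
  · rintro ⟨h1, h2⟩
    apply le_antisymm
    · have h3 : D.tn (D.idx τ) < D.tn (n + 1) := lt_of_le_of_lt (D.tn_idx_le τ) h2
      have := D.tn_strictMono.lt_iff_lt.1 h3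
      omega
    · exact le_csSup (D.idx_set_bddAbove τ) h1

/-! ### The rhombi of the strip and their coordinates -/

/-- The `n`-th rhombus `conv{L n, L n + w, L (n+1) + w, L (n+1)}`. [cite: Bruijn1981, §4 (ribbons of a rhombic tiling)] -/
def hull (n : ℤ) : Set ℂ := convexHull ℝ {D.L n, D.L n + D.w, D.L (n + 1) + D.w, D.L (n + 1)}

/-- `t` of the lower corners. [folklore] -/
theorem t_L (n : ℤ) : D.t (D.L n) = D.tn n := rfl

/-- `t` of the upper corners. [folklore] -/
theorem t_L_add_w (n : ℤ) : D.t (D.L n + D.w) = D.tn n := by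
  have := D.t_add_real_mul_w (D.L n) 1
  push_cast at this; rw [one_mul] at this
  exact this

/-- The `n`-th quadrilateral satisfies `IsQuad`. [folklore] -/
theorem isQuad (n : ℤ) : IsQuad (D.L n) (D.L n + D.w) (D.L (n + 1) + D.w) (D.L (n + 1)) := by
  have hlt : D.tn n < D.tn (n + 1) := D.tn_strictMono (lt_add_one n)
  refine ⟨by ring, ?_, ?_, ?_, ?_⟩
  · intro h
    have h1 : D.t (D.L n) = D.t (D.L (n + 1) + D.w) := by rw [h]
    rw [t_L, t_L_add_w] at h1
    exact hlt.ne h1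
  · intro h
    have h1 : D.t (D.L n + D.w) = D.t (D.L (n + 1)) := by rw [h]
    rw [t_L, t_L_add_w] at h1
    exact hlt.ne h1
  · rw [sub_add_cancel_left, norm_neg, D.norm_w]
  · have : D.L (n + 1) + D.w - (D.L n + D.w) = D.L (n + 1) - D.L n := by ring
    rw [this, D.norm_step]

/-- The determinant of the `n`-th frame is the height `tₙ₊₁ - tₙ`. [folklore] -/
theorem det_eq (n : ℤ) : sideFn (D.L n) (D.L n + D.w) (D.L (n + 1)) = D.tn (n + 1) - D.tn n := by
  simp only [tn, t_def, sideFn, add_sub_cancel_left]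
  rw [← Complex.sub_im]
  congr 1; ring

/-- The side functional of the `n`-th base side is `t - tₙ`. [folklore] -/
theorem sideFn_L (n : ℤ) (Y : ℂ) : sideFn (D.L n) (D.L n + D.w) Y = D.t Y - D.tn n := by
  simp only [tn, t_def, sideFn, add_sub_cancel_left]
  rw [← Complex.sub_im]
  congr 1; ring

/-- The transversal oblique coordinate of the `n`-th frame is `(t - tₙ)/(tₙ₊₁ - tₙ)`. [folklore] -/
theorem coordQ_eq (n : ℤ) (Y : ℂ) :
    coordQ (D.L n) (D.L n + D.w) (D.L (n + 1)) Y = (D.t Y - D.tn n) / (D.tn (n + 1) - D.tn n) := by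
  rw [coordQ, sideFn_L, det_eq]

/-- The longitudinal oblique coordinate of the `n`-th frame. [folklore] -/
def alpha (n : ℤ) (Y : ℂ) : ℝ := coordP (D.L n) (D.L n + D.w) (D.L (n + 1)) Y

/-- The frame coordinates are continuous. [folklore] -/
theorem continuous_alpha (n : ℤ) : Continuous (D.alpha n) := continuous_coordP _ _ _

/-- **Gluing**: on the common line `t = tₙ₊₁` of two consecutive slabs the two longitudinal
coordinates agree. [folklore] -/
theorem alpha_glue (n : ℤ) {Y : ℂ} (hY : D.t Y = D.tn (n + 1)) : D.alpha n Y = D.alpha (n + 1) Y := by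
  have hq := D.isQuad n
  have hD := hq.det_ne_zero
  have hβ : coordQ (D.L n) (D.L n + D.w) (D.L (n + 1)) Y = 1 := by
    rw [coordQ_eq, hY, div_self]
    exact sub_ne_zero.2 (D.tn_strictMono (lt_add_one n)).ne'
  have hYeq := eq_coord hD Y
  rw [hβ] at hYeq
  -- `Y = L (n+1) + α w`
  have hY' : Y = D.L (n + 1) + (D.alpha n Y : ℂ) * (D.L (n + 1) + D.w - D.L (n + 1)) +
      ((0 : ℝ) : ℂ) * (D.L (n + 1 + 1) - D.L (n + 1)) := by
    rw [alpha]; conv_lhs => rw [hYeq]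
    push_cast; ring
  have hD' := (D.isQuad (n + 1)).det_ne_zero
  have := coordP_of_eq hD' (D.alpha n Y) 0
  rw [← hY'] at this
  exact this.symm

/-- **The longitudinal coordinate** `a`: the oblique coordinate along `w` in the frame of the
slab containing the point. [folklore] -/
def a (Y : ℂ) : ℝ := D.alpha (D.idx (D.t Y)) Y

/-- On the `n`-th closed slab, `a` is the `n`-th longitudinal coordinate. [folklore] -/
theorem a_eq_alpha {n : ℤ} {Y : ℂ} (h1 : D.tn n ≤ D.t Y) (h2 : D.t Y ≤ D.tn (n + 1)) :
    D.a Y = D.alpha n Y := by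
  rcases h2.lt_or_eq with h2 | h2
  · rw [a, D.idx_eq_iff.2 ⟨h1, h2⟩]
  · have : D.idx (D.t Y) = n + 1 := by
      rw [D.idx_eq_iff]
      refine ⟨h2.ge, ?_⟩
      rw [h2]; exact D.tn_strictMono (lt_add_one _)
    rw [a, this, ← D.alpha_glue n h2]

/-- The closed slabs. [folklore] -/
def slab (n : ℤ) : Set ℂ := {Y | D.tn n ≤ D.t Y ∧ D.t Y ≤ D.tn (n + 1)}

/-- Slabs are closed. [folklore] -/
theorem isClosed_slab (n : ℤ) : IsClosed (D.slab n) :=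
  (isClosed_le continuous_const D.continuous_t).inter (isClosed_le D.continuous_t continuous_const)

/-- The slabs cover the plane. [folklore] -/
theorem iUnion_slab : ⋃ n, D.slab n = univ := by
  refine eq_univ_of_forall fun Y => mem_iUnion.2 ⟨D.idx (D.t Y), D.tn_idx_le _, (D.lt_tn_idx_succ _).le⟩

/-- The slabs form a locally finite family. [folklore] -/
theorem locallyFinite_slab : LocallyFinite D.slab := by
  intro Y
  obtain ⟨N₁, hN₁⟩ := D.exists_lt_tn (D.t Y + 1)
  obtain ⟨N₀, hN₀⟩ := D.exists_tn_le (D.t Y - 1)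
  refine ⟨D.t ⁻¹' Ioo (D.t Y - 1) (D.t Y + 1), ?_, ?_⟩
  · exact D.continuous_t.isOpen_preimage _ isOpen_Ioo |>.mem_nhds
      (by simp only [mem_preimage, mem_Ioo]; constructor <;> linarith)
  · refine (Set.finite_Ioo (N₀ - 1) N₁).subset ?_
    rintro n ⟨Z, ⟨hZ1, hZ2⟩, hZ3, hZ4⟩
    constructor
    · have : D.tn N₀ < D.tn (n + 1) := by linarith
      have := D.tn_strictMono.lt_iff_lt.1 this
      omega
    · have : D.tn n < D.tn N₁ := by linarith
      exact D.tn_strictMono.lt_iff_lt.1 this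

/-- **The longitudinal coordinate is continuous** (the frames glue along the slab boundaries).
[folklore] -/
theorem continuous_a : Continuous D.a := by
  refine D.locallyFinite_slab.continuous D.iUnion_slab D.isClosed_slab fun n => ?_
  exact (D.continuous_alpha n).continuousOn.congr fun Y hY => D.a_eq_alpha hY.1 hY.2

/-- **The rhombi lie in their slabs and in `{0 ≤ a ≤ 1}`.** [folklore] -/
theorem hull_subset (n : ℤ) : D.hull n ⊆ D.slab n ∩ {Y | 0 ≤ D.a Y ∧ D.a Y ≤ 1} := by
  intro Y hY
  have hq := D.isQuad n
  rw [hull, convexHull_quad_eq_coord hq] at hY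
  obtain ⟨⟨hα0, hα1⟩, ⟨hβ0, hβ1⟩⟩ := hY
  rw [coordQ_eq] at hβ0 hβ1
  have hΔ : 0 < D.tn (n + 1) - D.tn n := sub_pos.2 (D.tn_strictMono (lt_add_one n))
  have h1 : D.tn n ≤ D.t Y := by
    have := mul_nonneg hβ0 hΔ.le
    rw [div_mul_cancel₀ _ hΔ.ne'] at this; linarith
  have h2 : D.t Y ≤ D.tn (n + 1) := by
    have := mul_le_mul_of_nonneg_right hβ1 hΔ.le
    rw [div_mul_cancel₀ _ hΔ.ne', one_mul] at this; linarith
  refine ⟨⟨h1, h2⟩, ?_⟩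
  show 0 ≤ D.a Y ∧ D.a Y ≤ 1
  rw [D.a_eq_alpha h1 h2]
  exact ⟨hα0, hα1⟩

/-- **`{0 ≤ a ≤ 1}` is covered by the rhombi**: a point with `0 ≤ a ≤ 1` lies in the rhombus of
its slab. [folklore] -/
theorem mem_hull_idx {Y : ℂ} (h0 : 0 ≤ D.a Y) (h1 : D.a Y ≤ 1) : Y ∈ D.hull (D.idx (D.t Y)) := by
  set n := D.idx (D.t Y) with hn
  have hq := D.isQuad n
  have ht1 : D.tn n ≤ D.t Y := D.tn_idx_le _
  have ht2 : D.t Y < D.tn (n + 1) := D.lt_tn_idx_succ _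
  rw [hull, convexHull_quad_eq_coord hq]
  have ha : D.a Y = D.alpha n Y := D.a_eq_alpha ht1 ht2.le
  have hΔ : 0 < D.tn (n + 1) - D.tn n := sub_pos.2 (D.tn_strictMono (lt_add_one n))
  refine ⟨⟨by rw [← alpha, ← ha]; exact h0, by rw [← alpha, ← ha]; exact h1⟩, ⟨?_, ?_⟩⟩
  · rw [coordQ_eq]; exact div_nonneg (by linarith) hΔ.le
  · rw [coordQ_eq, div_le_one hΔ]; linarith

/-- `a (L n) = 0`. [folklore] -/
theorem a_L (n : ℤ) : D.a (D.L n) = 0 := by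
  rw [D.a_eq_alpha (n := n) (by rw [t_L]) (by rw [t_L]; exact (D.tn_strictMono (lt_add_one n)).le),
    alpha, coordP_A]

/-- `a (L n + w) = 1`. [folklore] -/
theorem a_L_add_w (n : ℤ) : D.a (D.L n + D.w) = 1 := by
  rw [D.a_eq_alpha (n := n) (by rw [t_L_add_w])
    (by rw [t_L_add_w]; exact (D.tn_strictMono (lt_add_one n)).le), alpha,
    coordP_P (D.isQuad n).det_ne_zero]

/-! ### The two sides of the strip -/

/-- **A convex body whose interior misses every rhombus of the strip lies on one side of it.**
[cite: Bruijn1981, §4 (ribbons of a rhombic tiling)] -/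
theorem subset_or_subset {K : Set ℂ} (hK : K ⊆ closure (interior K))
    (hconv : Convex ℝ (interior K)) (hdisj : ∀ n, interior K ∩ D.hull n = ∅) :
    K ⊆ {Y | D.a Y ≤ 0} ∨ K ⊆ {Y | 1 ≤ D.a Y} := by
  have hsub : interior K ⊆ {Y | D.a Y < 0} ∪ {Y | 1 < D.a Y} := by
    intro Y hY
    by_contra h
    simp only [mem_union, mem_setOf_eq, not_or, not_lt] at h
    have hmem := D.mem_hull_idx h.1 h.2
    have : Y ∈ interior K ∩ D.hull (D.idx (D.t Y)) := ⟨hY, hmem⟩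
    rw [hdisj] at this
    exact this
  have ho1 : IsOpen {Y | D.a Y < 0} := isOpen_lt D.continuous_a continuous_const
  have ho2 : IsOpen {Y | 1 < D.a Y} := isOpen_lt continuous_const D.continuous_a
  have hd : Disjoint {Y | D.a Y < 0} {Y | 1 < D.a Y} := by
    rw [Set.disjoint_left]
    intro Y h1 h2
    simp only [mem_setOf_eq] at h1 h2
    linarith
  rcases hconv.isPreconnected.subset_or_subset ho1 ho2 hd hsub with h | h
  · left
    refine hK.trans (closure_minimal (h.trans fun Y hY => show D.a Y ≤ 0 from le_of_lt hY) ?_)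
    exact isClosed_le D.continuous_a continuous_const
  · right
    refine hK.trans (closure_minimal (h.trans fun Y hY => show 1 ≤ D.a Y from le_of_lt hY) ?_)
    exact isClosed_le continuous_const D.continuous_a

/-- **A segment from one side of the strip to the other meets the strip.** [folklore] -/
theorem exists_mem_segment {Y Y' : ℂ} (hY : D.a Y ≤ 0) (hY' : 1 ≤ D.a Y') :
    ∃ Z ∈ segment ℝ Y Y', 0 ≤ D.a Z ∧ D.a Z ≤ 1 := by
  set γ : ℝ → ℂ := fun θ => (1 - θ) • Y + θ • Y' with hγ
  have hγc : Continuous γ := by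
    simp only [hγ]
    fun_prop
  have hf : ContinuousOn (fun θ => D.a (γ θ)) (Icc 0 1) := (D.continuous_a.comp hγc).continuousOn
  have h0 : D.a (γ 0) ≤ 0 := by simp only [hγ]; simpa using hY
  have h1 : 1 ≤ D.a (γ 1) := by simp only [hγ]; simpa using hY'
  have hmem : (1 / 2 : ℝ) ∈ Icc (D.a (γ 0)) (D.a (γ 1)) := ⟨by linarith, by linarith⟩
  obtain ⟨θ, hθ, hθv⟩ := intermediate_value_Icc (zero_le_one) hf hmem
  refine ⟨γ θ, ?_, ?_, ?_⟩
  · rw [segment_eq_image]; exact ⟨θ, hθ, rfl⟩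
  · simp only at hθv; rw [hθv]; norm_num
  · simp only at hθv; rw [hθv]; norm_num

/-- The same with the roles of the two sides exchanged. [folklore] -/
theorem exists_mem_segment' {Y Y' : ℂ} (hY : 1 ≤ D.a Y) (hY' : D.a Y' ≤ 0) :
    ∃ Z ∈ segment ℝ Y Y', 0 ≤ D.a Z ∧ D.a Z ≤ 1 := by
  obtain ⟨Z, hZ, h⟩ := D.exists_mem_segment hY' hY
  exact ⟨Z, by rw [segment_symm]; exact hZ, h⟩

end StripData

end Literature.Probability.Percolation

end

/-!
# Planarity of rhombic tilings, VII: de Bruijn's ribbons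

Topic `Literature/Probability/Percolation`. For a preconnected graph isoradially embedded with
the tiling condition and bounded angles (`PlanarTilingHyps`), the rhombic tiling is edge-to-edge
(file V), so crossing a rhombus from a side to the opposite side and continuing across that
side into the next rhombus is a well-defined, reversible dynamics on the *states* (an edge
together with one of its sides). Its orbits are de Bruijn's **ribbons** = Grimmett–Manolescu's
**train tracks** (GM 2014, §4.2; de Bruijn 1981, §4; Kenyon–Schlenker 2005, §3), here obtained
*geometrically* (as chains of rhombi sharing geometric sides), before the labels of the shared
sides are known to agree.

* `Ribbon.St`, `Ribbon.next`, `Ribbon.flip`, `Ribbon.prev`, `Ribbon.perm` — the states and the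
  crossing permutation; `Ribbon.seq` — the bi-infinite sequence of states of the ribbon through
  a state, `Ribbon.edge`/`Ribbon.exit`/`Ribbon.entry`;
* `Ribbon.entry_pair_succ` — consecutive rhombi share the geometric side (exit of one = entry
  of the next);
* the **shape of a ribbon** (`Ribbon.stripData`): all shared sides are translates of one unit
  vector, the transversal coordinate increases by at least `2 sin² ε` at each step (bounded
  angles: the area of a rhombus is at least `2 sin² ε`, `abs_sideFn_ge`), so that the ribbon is
  a *strip* in the sense of file VI (`Ribbon.hull_eq_rhombus`): in particular **ribbons are
  simple and bi-infinite and go to infinity in both directions** (GM §4.2: "the rhombi in a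
  track are distinct"; Kenyon–Schlenker Thm 3.1);
* `Ribbon.rhombus_subset_or_subset` — a rhombus not on the ribbon lies on one side of it;
  `Ribbon.a_corner_exit/entry/lateral` — the longitudinal coordinate at the corners of the
  rhombi of the ribbon; `Ribbon.acrossEdge_lateral_not_mem` — the rhombus across a lateral
  side of a rhombus of the ribbon is not on the ribbon (**each rhombus lies on exactly two
  ribbons**, GM §4.2).

## References

* N. G. de Bruijn, *Algebraic theory of Penrose's non-periodic tilings of the plane*, Indag.
  Math. 43 (1981), §4.
* G. R. Grimmett, I. Manolescu, *Bond percolation on isoradial graphs*, PTRF 159 (2014),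
  arXiv:1204.0505, §4.2 (track systems).
* R. Kenyon, J.-M. Schlenker, *Rhombic embeddings of planar quad-graphs*, TAMS 357 (2005), §3.
-/

noncomputable section

open Complex ComplexConjugate Metric Set Filter Topology

namespace Literature.Probability.Percolation

open Literature.Probability.LatticeModels IsoradialCriticality

variable {V F : Type*} {G : SimpleGraph V} {emb : RhombicEmbedding G F} {ε : ℝ}
variable [DecidableEq V] [DecidableEq F]

/-! ### Sides of an edge: the quadrilateral from a side, equality of sides -/

section SidesOfEdge

/-- **The quadrilateral of an edge read from one of its sides**: for `q ∈ sides e` with opposite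
side `q̄`, `(z q.1, c q.2, z q̄.1, c q̄.2)` satisfies `IsQuad` and spans the rhombus of `e`.
[cite: GrimmettManolescu2014Isoradial, §2.1 (the rhombus A O₁ B O₂) and §4.2 (opposite sides)] -/
theorem isQuad_oppositeSide (hiso : emb.IsIsoradial) (e : G.edgeSet) {q : V × F}
    (hq : q ∈ emb.sides e) :
    IsQuad (emb.z q.1) (emb.c q.2) (emb.z (emb.oppositeSide e q).1) (emb.c (emb.oppositeSide e q).2) ∧
      convexHull ℝ ({emb.z q.1, emb.c q.2, emb.z (emb.oppositeSide e q).1,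
        emb.c (emb.oppositeSide e q).2} : Set ℂ) = emb.rhombus e ∧
      ‖(emb.z q.1 - emb.z (emb.oppositeSide e q).1) / 2‖ =
        ‖(emb.z (RhombicEmbedding.refDart e).fst - emb.z (RhombicEmbedding.refDart e).snd) / 2‖ ∧
      ‖(emb.c q.2 - emb.c (emb.oppositeSide e q).2) / 2‖ =
        ‖(emb.c (emb.leftFace (RhombicEmbedding.refDart e)) -
          emb.c (emb.rightFace (RhombicEmbedding.refDart e))) / 2‖ ∧
      ({emb.z q.1, emb.z (emb.oppositeSide e q).1} : Set ℂ) =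
        {emb.z (RhombicEmbedding.refDart e).fst, emb.z (RhombicEmbedding.refDart e).snd} ∧
      ({emb.c q.2, emb.c (emb.oppositeSide e q).2} : Set ℂ) =
        {emb.c (emb.leftFace (RhombicEmbedding.refDart e)),
          emb.c (emb.rightFace (RhombicEmbedding.refDart e))} := by
  set d := RhombicEmbedding.refDart e with hd
  have hde : (⟨d.edge, d.edge_mem⟩ : G.edgeSet) = e := Subtype.ext (RhombicEmbedding.refDart_edge e)
  have hquad := dart_isQuad hiso d
  have hK : emb.rhombus e = convexHull ℝ {emb.z d.fst, emb.c (emb.leftFace d), emb.z d.snd,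
      emb.c (emb.rightFace d)} := by rw [← hde]; exact rhombus_dart_eq hiso d
  obtain ⟨o1, o2, o3, o4⟩ := emb.dartOppositeSide_apply d
    (fun h => hiso.c_leftFace_ne d (congrArg emb.c h))
  have hopp : emb.oppositeSide e = emb.dartOppositeSide d := rfl
  change q ∈ emb.dartSides d at hq
  rw [hopp, hK]
  rcases (mem_dartSides_iff d q).1 hq with rfl | rfl | rfl | rfl
  · rw [o1]; exact ⟨hquad, rfl, rfl, rfl, rfl, rfl⟩
  · rw [o3]; dsimp only
    refine ⟨hquad.swapAB, IsQuad.hull_swapAB _ _ _ _, ?_, rfl, Set.pair_comm _ _, rfl⟩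
    rw [← norm_neg]; congr 1; ring
  · rw [o2]; dsimp only
    refine ⟨hquad.swapAB.swapPQ, ?_, ?_, ?_, Set.pair_comm _ _, Set.pair_comm _ _⟩
    · rw [IsQuad.hull_swapPQ, IsQuad.hull_swapAB]
    · rw [← norm_neg]; congr 1; ring
    · rw [← norm_neg]; congr 1; ring
  · rw [o4]; dsimp only
    refine ⟨hquad.swapPQ, IsQuad.hull_swapPQ _ _ _ _, rfl, ?_, rfl, Set.pair_comm _ _⟩
    rw [← norm_neg]; congr 1; ring

/-- **The four sides of an edge, from one of them**: `q`, its opposite `q̄`, and the two lateral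
sides `(q.1, q̄.2)`, `(q̄.1, q.2)`. [cite: GrimmettManolescu2014Isoradial, §2.1 (the rhombus A O₁ B O₂)] -/
theorem mem_sides_iff_of_mem (hiso : emb.IsIsoradial) (e : G.edgeSet) {q : V × F}
    (hq : q ∈ emb.sides e) (s : V × F) :
    s ∈ emb.sides e ↔ s = q ∨ s = emb.oppositeSide e q ∨ s = (q.1, (emb.oppositeSide e q).2) ∨
      s = ((emb.oppositeSide e q).1, q.2) := by
  set d := RhombicEmbedding.refDart e with hd
  obtain ⟨o1, o2, o3, o4⟩ := emb.dartOppositeSide_apply d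
    (fun h => hiso.c_leftFace_ne d (congrArg emb.c h))
  have hopp : emb.oppositeSide e = emb.dartOppositeSide d := rfl
  change q ∈ emb.dartSides d at hq
  change s ∈ emb.dartSides d ↔ _
  rw [hopp, mem_dartSides_iff]
  rcases (mem_dartSides_iff d q).1 hq with rfl | rfl | rfl | rfl
  · rw [o1]; dsimp only; tauto
  · rw [o3]; dsimp only; tauto
  · rw [o2]; dsimp only; tauto
  · rw [o4]; dsimp only; tauto

/-- **The area bound**: for a quadrilateral with `IsQuad`, `|sideFn A P Q| = 2 ‖a‖ ‖p‖` (twice the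
product of the half-diagonals, which are perpendicular). [cite: GrimmettManolescu2014Isoradial, §2.1 (2.2) (the area of a rhombus)] -/
theorem abs_sideFn_APQ {A P B Q : ℂ} (h : IsQuad A P B Q) :
    |sideFn A P Q| = 2 * ‖(A - B) / 2‖ * ‖(P - Q) / 2‖ := by
  obtain ⟨-, horth⟩ := rhombus_halfDiag h.sum h.norm_AP h.norm_BP
  set a : ℂ := (A - B) / 2 with ha
  set p : ℂ := (P - Q) / 2 with hp
  have h1 : Q - A = -p - a := by simp only [ha, hp]; linear_combination (1 / 2 : ℂ) * h.sum
  have h2 : P - A = p - a := by simp only [ha, hp]; linear_combination (1 / 2 : ℂ) * h.sum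
  have key : sideFn A P Q = -2 * (a * conj p).im := by
    simp only [sideFn, h1, h2, map_sub]
    have : (-p - a) * (conj p - conj a) = -(p * conj p) + (a * conj a) + (p * conj a - a * conj p) := by
      ring
    rw [this, Complex.add_im, Complex.add_im, Complex.neg_im, Complex.mul_conj, Complex.mul_conj,
      Complex.ofReal_im, Complex.ofReal_im, Complex.sub_im]
    have h3 : (p * conj a).im = -(a * conj p).im := by
      have : p * conj a = conj (a * conj p) := by simp [mul_comm]
      rw [this, Complex.conj_im]
    rw [h3]; ring
  -- `a conj p` is purely imaginary, so `|Im| = ‖a conj p‖ = ‖a‖ ‖p‖`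
  have him : |(a * conj p).im| = ‖a‖ * ‖p‖ := by
    have hn : ‖a * conj p‖ = ‖a‖ * ‖p‖ := by rw [norm_mul, Complex.norm_conj]
    have hsq : ‖a * conj p‖ ^ 2 = (a * conj p).re ^ 2 + (a * conj p).im ^ 2 := by
      rw [← Complex.normSq_eq_norm_sq, Complex.normSq_apply]; ring
    rw [horth] at hsq
    have : |(a * conj p).im| ^ 2 = ‖a * conj p‖ ^ 2 := by rw [hsq, sq_abs]; ring
    have h0 : 0 ≤ ‖a * conj p‖ := norm_nonneg _
    nlinarith [abs_nonneg ((a * conj p).im), sq_nonneg (|(a * conj p).im| - ‖a * conj p‖),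
      sq_nonneg (|(a * conj p).im| + ‖a * conj p‖)]
  rw [key, abs_mul, him]
  norm_num; ring

/-- The corner points of the side `q` and of its opposite side are the four corners; in
particular the two sides have disjoint point sets. [folklore] -/
theorem pair_oppositeSide_eq (hiso : emb.IsIsoradial) (e : G.edgeSet) {q : V × F}
    (hq : q ∈ emb.sides e) :
    ({emb.z q.1, emb.c q.2} : Set ℂ) ∩ {emb.z (emb.oppositeSide e q).1, emb.c (emb.oppositeSide e q).2} = ∅ := by
  obtain ⟨hquad, -⟩ := isQuad_oppositeSide hiso e hq
  rw [Set.eq_empty_iff_forall_notMem]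
  rintro X ⟨h1, h2⟩
  simp only [mem_insert_iff, mem_singleton_iff] at h1 h2
  rcases h1 with rfl | rfl <;> rcases h2 with h | h
  · exact hquad.A_ne_B h
  · exact hquad.A_ne_Q h
  · exact hquad.B_ne_P h.symm
  · exact hquad.P_ne_Q h

/-- **Two sides of an edge with the same point set are equal** (the four sides of a rhombus are
four distinct segments; `z` and `c` are injective). [folklore] -/
theorem side_eq_of_pair_eq (hiso : emb.IsIsoradial) (hrh : emb.IsRhombicTiling) (e : G.edgeSet)
    {q₁ q₂ : V × F} (hq₁ : q₁ ∈ emb.sides e) (hq₂ : q₂ ∈ emb.sides e)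
    (h : ({emb.z q₁.1, emb.c q₁.2} : Set ℂ) = {emb.z q₂.1, emb.c q₂.2}) : q₁ = q₂ := by
  set d := RhombicEmbedding.refDart e with hd
  change q₁ ∈ emb.dartSides d at hq₁
  change q₂ ∈ emb.dartSides d at hq₂
  have hquad := dart_isQuad hiso d
  -- primal corners are never dual corners of the same rhombus
  have hnot : ∀ {p : V × F}, p ∈ emb.dartSides d → ∀ {p' : V × F}, p' ∈ emb.dartSides d →
      emb.z p.1 ≠ emb.c p'.2 := by
    intro p hp p' hp'
    rcases (mem_dartSides_iff d p).1 hp with rfl | rfl | rfl | rfl <;>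
      rcases (mem_dartSides_iff d p').1 hp' with rfl | rfl | rfl | rfl <;> simp only
    · exact hquad.A_ne_P
    · exact hquad.A_ne_P
    · exact hquad.A_ne_Q
    · exact hquad.A_ne_Q
    · exact hquad.B_ne_P
    · exact hquad.B_ne_P
    · exact hquad.B_ne_Q
    · exact hquad.B_ne_Q
    · exact hquad.B_ne_P
    · exact hquad.B_ne_P
    · exact hquad.B_ne_Q
    · exact hquad.B_ne_Q
    · exact hquad.A_ne_P
    · exact hquad.A_ne_P
    · exact hquad.A_ne_Q
    · exact hquad.A_ne_Q
  have h1 : emb.z q₁.1 ∈ ({emb.z q₂.1, emb.c q₂.2} : Set ℂ) := by rw [← h]; simp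
  have h2 : emb.c q₁.2 ∈ ({emb.z q₂.1, emb.c q₂.2} : Set ℂ) := by rw [← h]; simp
  simp only [mem_insert_iff, mem_singleton_iff] at h1 h2
  rcases h1 with h1 | h1
  · rcases h2 with h2 | h2
    · exact absurd h2.symm (hnot hq₂ hq₁)
    · exact Prod.ext (hiso.z_injective h1) (hrh.c_injective h2)
  · exact absurd h1 (hnot hq₁ hq₂)

end SidesOfEdge

namespace Ribbon

/-! ### States and the crossing permutation -/

/-- A **state**: an edge of `G` together with one of the four sides of its rhombus (the side to
be crossed next). [cite: Bruijn1981, §4 (ribbons of a rhombic tiling)] -/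
def St (emb : RhombicEmbedding G F) : Type _ := {x : G.edgeSet × (V × F) // x.2 ∈ emb.sides x.1}

variable (H : PlanarTilingHyps emb ε)

/-- The side of the rhombus across the exit side having the same segment (`exists_side_acrossEdge`).
[cite: GrimmettManolescu2014Isoradial, §4.2 (consecutive rhombi of a track share a side)] -/
def matchSide (x : St emb) : V × F :=
  Classical.choose (exists_side_acrossEdge H x.1.1 x.2)

/-- The matched side is a side of the rhombus across. [folklore] -/
theorem matchSide_mem (x : St emb) : matchSide H x ∈ emb.sides (acrossEdge H x.1.1 x.1.2) :=
  (Classical.choose_spec (exists_side_acrossEdge H x.1.1 x.2)).1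

/-- The matched side has the same endpoints. [folklore] -/
theorem matchSide_pair (x : St emb) :
    ({emb.z (matchSide H x).1, emb.c (matchSide H x).2} : Set ℂ) = {emb.z x.1.2.1, emb.c x.1.2.2} :=
  (Classical.choose_spec (exists_side_acrossEdge H x.1.1 x.2)).2

/-- **Crossing**: go across the exit side into the next rhombus and take its opposite side as the
new exit side. [cite: Bruijn1981, §4 (ribbons of a rhombic tiling)] -/
def next (x : St emb) : St emb :=
  ⟨(acrossEdge H x.1.1 x.1.2, emb.oppositeSide (acrossEdge H x.1.1 x.1.2) (matchSide H x)),
    emb.oppositeSide_mem_sides (matchSide_mem H x)⟩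

/-- **Reversal**: replace the exit side by the opposite side. [folklore] -/
def flip (x : St emb) : St emb :=
  ⟨(x.1.1, emb.oppositeSide x.1.1 x.1.2), emb.oppositeSide_mem_sides x.2⟩

/-- Flipping a state twice gives it back. [folklore] -/
theorem flip_flip (x : St emb) : flip (flip x) = x := by
  apply Subtype.ext
  simp only [flip, emb.oppositeSide_oppositeSide]

/-- Going back: reverse, cross, reverse. [folklore] -/
def prev (x : St emb) : St emb := flip (next H (flip x))

/-- The edge component of the next state. [folklore] -/
theorem next_edge (x : St emb) : (next H x).1.1 = acrossEdge H x.1.1 x.1.2 := rfl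

/-- The side component of the next state. [folklore] -/
theorem next_side (x : St emb) :
    (next H x).1.2 = emb.oppositeSide (acrossEdge H x.1.1 x.1.2) (matchSide H x) := rfl

/-- The entry side of the next state is the matched side. [folklore] -/
theorem oppositeSide_next (x : St emb) :
    emb.oppositeSide (next H x).1.1 (next H x).1.2 = matchSide H x := by
  rw [next_side, next_edge, emb.oppositeSide_oppositeSide]

/-- **The core identity** `next (flip (next x)) = flip x`: crossing back across the shared side
returns to the same rhombus, entered through the same side. [folklore] -/
theorem next_flip_next (x : St emb) : next H (flip (next H x)) = flip x := by
  obtain ⟨⟨e, p⟩, hp⟩ := x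
  change p ∈ emb.sides e at hp
  set e' := acrossEdge H e p with he'
  set m := matchSide H ⟨(e, p), hp⟩ with hm
  have hm_mem : m ∈ emb.sides e' := matchSide_mem H ⟨(e, p), hp⟩
  have hm_pair : ({emb.z m.1, emb.c m.2} : Set ℂ) = {emb.z p.1, emb.c p.2} :=
    matchSide_pair H ⟨(e, p), hp⟩
  -- `flip (next x) = (e', m)`
  have hfn : flip (next H ⟨(e, p), hp⟩) = ⟨(e', m), hm_mem⟩ := by
    apply Subtype.ext
    simp only [flip, next, emb.oppositeSide_oppositeSide]
    rfl
  rw [hfn]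
  -- across `m` from `e'` lies `e`
  have hback : acrossEdge H e' m = e := acrossEdge_acrossEdge H e hp hm_mem hm_pair
  -- the matched side of `(e', m)` is `p`
  set m' := matchSide H ⟨(e', m), hm_mem⟩ with hm'
  have hm'_mem : m' ∈ emb.sides (acrossEdge H e' m) := matchSide_mem H ⟨(e', m), hm_mem⟩
  have hm'_pair : ({emb.z m'.1, emb.c m'.2} : Set ℂ) = {emb.z m.1, emb.c m.2} :=
    matchSide_pair H ⟨(e', m), hm_mem⟩
  rw [hback] at hm'_mem
  have hm'p : m' = p := side_eq_of_pair_eq H.iso H.tiling e hm'_mem hp (hm'_pair.trans hm_pair)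
  apply Subtype.ext
  show (acrossEdge H e' m, emb.oppositeSide (acrossEdge H e' m) m') = (e, emb.oppositeSide e p)
  rw [hback, hm'p]

/-- `prev` is a left inverse of `next`. [folklore] -/
theorem prev_next (x : St emb) : prev H (next H x) = x := by
  rw [prev, next_flip_next, flip_flip]

/-- `prev` is a right inverse of `next`. [folklore] -/
theorem next_prev (x : St emb) : next H (prev H x) = x := by
  rw [prev]
  have := next_flip_next H (flip x)
  rw [flip_flip] at this
  exact this

/-- **The crossing permutation** of the states. [cite: Bruijn1981, §4 (ribbons of a rhombic tiling)] -/
def perm : Equiv.Perm (St emb) where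
  toFun := next H
  invFun := prev H
  left_inv := prev_next H
  right_inv := next_prev H

/-- The ribbon permutation is `next`. [folklore] -/
theorem perm_apply (x : St emb) : perm H x = next H x := rfl

/-! ### The ribbon through a state -/

/-- The `n`-th state of the ribbon through `x₀` (`n ∈ ℤ`). [cite: Bruijn1981, §4 (ribbons of a rhombic tiling)] -/
def seq (x₀ : St emb) (n : ℤ) : St emb := (perm H ^ n) x₀

/-- The `n`-th edge (rhombus) of the ribbon. [cite: GrimmettManolescu2014Isoradial, §4.2 (a track is a doubly infinite sequence of rhombi)] -/
def edge (x₀ : St emb) (n : ℤ) : G.edgeSet := (seq H x₀ n).1.1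

/-- The exit side of the `n`-th rhombus. [folklore] -/
def exit (x₀ : St emb) (n : ℤ) : V × F := (seq H x₀ n).1.2

/-- The entry side of the `n`-th rhombus (opposite to the exit side). [folklore] -/
def entry (x₀ : St emb) (n : ℤ) : V × F := emb.oppositeSide (edge H x₀ n) (exit H x₀ n)

variable (x₀ : St emb)

/-- The ribbon sequence starts at the given state. [folklore] -/
theorem seq_zero : seq H x₀ 0 = x₀ := by simp [seq]

/-- One step forward along the ribbon. [folklore] -/
theorem seq_succ (n : ℤ) : seq H x₀ (n + 1) = next H (seq H x₀ n) := by
  simp only [seq]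
  rw [add_comm, zpow_add, zpow_one, Equiv.Perm.mul_apply, perm_apply]

/-- One step backward along the ribbon. [folklore] -/
theorem seq_pred (n : ℤ) : seq H x₀ (n - 1) = prev H (seq H x₀ n) := by
  have := seq_succ H x₀ (n - 1)
  rw [sub_add_cancel] at this
  rw [this, prev_next]

/-- The exit side is a side of the current rhombus. [folklore] -/
theorem exit_mem (n : ℤ) : exit H x₀ n ∈ emb.sides (edge H x₀ n) := (seq H x₀ n).2

/-- The entry side is a side of the current rhombus. [folklore] -/
theorem entry_mem (n : ℤ) : entry H x₀ n ∈ emb.sides (edge H x₀ n) :=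
  emb.oppositeSide_mem_sides (exit_mem H x₀ n)

/-- The exit side is opposite to the entry side. [folklore] -/
theorem oppositeSide_entry (n : ℤ) :
    emb.oppositeSide (edge H x₀ n) (entry H x₀ n) = exit H x₀ n := by
  rw [entry, emb.oppositeSide_oppositeSide]

/-- The next edge is the edge across the exit side. [cite: GrimmettManolescu2014Isoradial, §4.2 (a track is a doubly infinite sequence of rhombi)] -/
theorem edge_succ (n : ℤ) : edge H x₀ (n + 1) = acrossEdge H (edge H x₀ n) (exit H x₀ n) := by
  simp only [edge, exit, seq_succ, next_edge]

/-- Consecutive edges of a ribbon are distinct. [cite: GrimmettManolescu2014Isoradial, §4.2 (the rhombi in a track are distinct)] -/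
theorem edge_succ_ne (n : ℤ) : edge H x₀ (n + 1) ≠ edge H x₀ n := by
  rw [edge_succ]; exact acrossEdge_ne H _ (exit_mem H x₀ n)

/-- **Consecutive rhombi share the geometric side**: the entry side of rhombus `n + 1` and the
exit side of rhombus `n` have the same segment. [cite: GrimmettManolescu2014Isoradial, §4.2 (each rhombus shares a side with the next)] -/
theorem entry_pair_succ (n : ℤ) :
    ({emb.z (entry H x₀ (n + 1)).1, emb.c (entry H x₀ (n + 1)).2} : Set ℂ) =
      {emb.z (exit H x₀ n).1, emb.c (exit H x₀ n).2} := by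
  have h1 : entry H x₀ (n + 1) = matchSide H (seq H x₀ n) := by
    simp only [entry, edge, exit, seq_succ]
    exact oppositeSide_next H _
  rw [h1]
  exact matchSide_pair H (seq H x₀ n)

/-- Ribbons through states of a ribbon are the same ribbon, re-indexed. [folklore] -/
theorem seq_seq (n m : ℤ) : seq H (seq H x₀ n) m = seq H x₀ (m + n) := by
  simp only [seq, ← Equiv.Perm.mul_apply, ← zpow_add]

/-- Reversal: the ribbon through the reversed state visits the same edges backwards. [folklore] -/
theorem seq_flip (n : ℤ) : seq H (flip x₀) n = flip (seq H x₀ (-n)) := by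
  induction n using Int.induction_on with
  | zero => simp [seq_zero]
  | succ n ih =>
    rw [seq_succ, ih]
    have : -((n : ℤ) + 1) = -(n : ℤ) - 1 := by ring
    rw [this, seq_pred, prev, flip_flip]
  | pred n ih =>
    rw [seq_pred, ih]
    have : -(-(n : ℤ) - 1) = -(-(n : ℤ)) + 1 := by ring
    rw [this, seq_succ, prev, flip_flip]

/-- The rhombi of the flipped ribbon, reindexed. [folklore] -/
theorem edge_flip (n : ℤ) : edge H (flip x₀) n = edge H x₀ (-n) := by
  simp only [edge, seq_flip]; rfl

/-- The set of edges of a ribbon does not depend on the direction of traversal. [folklore] -/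
theorem range_edge_flip : Set.range (edge H (flip x₀)) = Set.range (edge H x₀) := by
  ext e
  simp only [Set.mem_range, edge_flip]
  constructor
  · rintro ⟨n, rfl⟩; exact ⟨-n, rfl⟩
  · rintro ⟨n, rfl⟩; exact ⟨-n, by rw [neg_neg]⟩

/-- The set of edges of a ribbon does not depend on the base state on it. [folklore] -/
theorem range_edge_seq (n : ℤ) : Set.range (edge H (seq H x₀ n)) = Set.range (edge H x₀) := by
  ext e
  simp only [Set.mem_range, edge, seq_seq]
  constructor
  · rintro ⟨m, rfl⟩; exact ⟨m + n, rfl⟩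
  · rintro ⟨m, rfl⟩; exact ⟨m - n, by rw [sub_add_cancel]⟩

/-! ### The shape of a ribbon -/

section Shape

/-- Entry corner `A n = z (entry n).1`. [folklore] -/
def cA (n : ℤ) : ℂ := emb.z (entry H x₀ n).1
/-- Entry corner `P n = c (entry n).2`. [folklore] -/
def cP (n : ℤ) : ℂ := emb.c (entry H x₀ n).2
/-- Exit corner `B n = z (exit n).1`. [folklore] -/
def cB (n : ℤ) : ℂ := emb.z (exit H x₀ n).1
/-- Exit corner `Q n = c (exit n).2`. [folklore] -/
def cQ (n : ℤ) : ℂ := emb.c (exit H x₀ n).2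

/-- The quadrilateral of the `n`-th rhombus read from its entry side. [cite: GrimmettManolescu2014Isoradial, §2.1 (the rhombus A O₁ B O₂)] -/
theorem quad (n : ℤ) :
    IsQuad (cA H x₀ n) (cP H x₀ n) (cB H x₀ n) (cQ H x₀ n) ∧
      convexHull ℝ ({cA H x₀ n, cP H x₀ n, cB H x₀ n, cQ H x₀ n} : Set ℂ) = emb.rhombus (edge H x₀ n) ∧
      ‖(cA H x₀ n - cB H x₀ n) / 2‖ =
        ‖(emb.z (RhombicEmbedding.refDart (edge H x₀ n)).fst -
          emb.z (RhombicEmbedding.refDart (edge H x₀ n)).snd) / 2‖ ∧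
      ‖(cP H x₀ n - cQ H x₀ n) / 2‖ =
        ‖(emb.c (emb.leftFace (RhombicEmbedding.refDart (edge H x₀ n))) -
          emb.c (emb.rightFace (RhombicEmbedding.refDart (edge H x₀ n)))) / 2‖ ∧
      ({cA H x₀ n, cB H x₀ n} : Set ℂ) =
        {emb.z (RhombicEmbedding.refDart (edge H x₀ n)).fst,
          emb.z (RhombicEmbedding.refDart (edge H x₀ n)).snd} ∧
      ({cP H x₀ n, cQ H x₀ n} : Set ℂ) =
        {emb.c (emb.leftFace (RhombicEmbedding.refDart (edge H x₀ n))),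
          emb.c (emb.rightFace (RhombicEmbedding.refDart (edge H x₀ n)))} := by
  have := isQuad_oppositeSide H.iso (edge H x₀ n) (entry_mem H x₀ n)
  simp only [oppositeSide_entry] at this
  exact this

/-- Consecutive rhombi share the side: `{A (n+1), P (n+1)} = {B n, Q n}`. [cite: GrimmettManolescu2014Isoradial, §4.2 (each rhombus shares a side with the next)] -/
theorem entry_corners_succ (n : ℤ) :
    ({cA H x₀ (n + 1), cP H x₀ (n + 1)} : Set ℂ) = {cB H x₀ n, cQ H x₀ n} :=
  entry_pair_succ H x₀ n

/-- The reference unit vector `w₀ = P 0 - A 0` of the ribbon. [folklore] -/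
def w₀ : ℂ := cP H x₀ 0 - cA H x₀ 0

/-- The shared direction of the starting rhombus is a unit vector. [folklore] -/
theorem norm_w₀ : ‖w₀ H x₀‖ = 1 := by
  rw [w₀, norm_sub_rev]; exact (quad H x₀ 0).1.norm_AP

/-- **All shared sides are translates of `w₀`**: `P n - A n = ± w₀`. [cite: Bruijn1981, §4 (the sides crossed by a ribbon are parallel)] -/
theorem entry_vec (n : ℤ) : cP H x₀ n - cA H x₀ n = w₀ H x₀ ∨ cP H x₀ n - cA H x₀ n = -w₀ H x₀ := by
  induction n using Int.induction_on with
  | zero => left; rfl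
  | succ n ih =>
    have hsum := (quad H x₀ n).1.sum
    have hpair := entry_corners_succ H x₀ n
    rcases Set.pair_eq_pair_iff.1 hpair with ⟨h1, h2⟩ | ⟨h1, h2⟩
    · rw [h1, h2]
      have : cQ H x₀ n - cB H x₀ n = -(cP H x₀ n - cA H x₀ n) := by linear_combination hsum
      rw [this]; rcases ih with h | h
      · right; rw [h]
      · left; rw [h, neg_neg]
    · rw [h1, h2]
      have : cB H x₀ n - cQ H x₀ n = cP H x₀ n - cA H x₀ n := by linear_combination (-1 : ℂ) * hsum
      rw [this]; exact ih
  | pred n ih =>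
    -- from rhombus `-n` back to rhombus `-n - 1`
    have hsum := (quad H x₀ (-n - 1)).1.sum
    have hpair := entry_corners_succ H x₀ (-n - 1)
    rw [sub_add_cancel] at hpair
    rcases Set.pair_eq_pair_iff.1 hpair with ⟨h1, h2⟩ | ⟨h1, h2⟩
    · rw [h1, h2] at ih
      have : cP H x₀ (-n - 1) - cA H x₀ (-n - 1) = -(cQ H x₀ (-n - 1) - cB H x₀ (-n - 1)) := by
        linear_combination hsum
      rw [this]; rcases ih with h | h
      · right; rw [h]
      · left; rw [h, neg_neg]
    · rw [h1, h2] at ih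
      have : cP H x₀ (-n - 1) - cA H x₀ (-n - 1) = cB H x₀ (-n - 1) - cQ H x₀ (-n - 1) := by
        linear_combination hsum
      rw [this]; exact ih

/-- The exit side is also a translate of `w₀`: `Q n - B n = ∓ w₀`. [folklore] -/
theorem exit_vec (n : ℤ) : cQ H x₀ n - cB H x₀ n = -(cP H x₀ n - cA H x₀ n) := by
  linear_combination (quad H x₀ n).1.sum

/-- The transversal increment `h n = Im((Q n - A n) w̄₀)` of the `n`-th rhombus. [folklore] -/
def hinc (n : ℤ) : ℝ := ((cQ H x₀ n - cA H x₀ n) * conj (w₀ H x₀)).im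

/-- `|h n| = |sideFn (A n) (P n) (Q n)|`. [folklore] -/
theorem abs_hinc (n : ℤ) : |hinc H x₀ n| = |sideFn (cA H x₀ n) (cP H x₀ n) (cQ H x₀ n)| := by
  simp only [hinc, sideFn]
  rcases entry_vec H x₀ n with h | h
  · rw [h]
  · have : w₀ H x₀ = -(cP H x₀ n - cA H x₀ n) := by rw [h, neg_neg]
    rw [this, map_neg, mul_neg, Complex.neg_im, abs_neg]

/-- **The area bound**: `|h n| ≥ 2 sin² ε`. [cite: GrimmettManolescu2014Isoradial, §2.1 (2.2) (BAP(ε) bounds the area of the rhombi below)] -/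
theorem eta_le_abs_hinc (n : ℤ) : 2 * (Real.sin ε * Real.sin ε) ≤ |hinc H x₀ n| := by
  obtain ⟨hq, -, hna, hnp, -, -⟩ := quad H x₀ n
  rw [abs_hinc, abs_sideFn_APQ hq, hna, hnp]
  set d := RhombicEmbedding.refDart (edge H x₀ n) with hd
  obtain ⟨h1, h2⟩ := sin_le_halfDiag H.iso H.bap H.pos d
  have hs : 0 < Real.sin ε := sin_pos_of_hasBoundedAngles H.bap H.pos d
  nlinarith [norm_nonneg ((emb.z d.fst - emb.z d.snd) / 2), mul_le_mul h1 h2 hs.le (norm_nonneg _)]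

/-- Consecutive shared sides are at different heights. [folklore] -/
theorem hinc_ne_zero (n : ℤ) : hinc H x₀ n ≠ 0 := by
  intro h
  have := eta_le_abs_hinc H x₀ n
  rw [h, abs_zero] at this
  have hs : 0 < Real.sin ε :=
    sin_pos_of_hasBoundedAngles H.bap H.pos (RhombicEmbedding.refDart (edge H x₀ n))
  nlinarith [mul_pos hs hs]

/-- The reference transversal coordinate `t₀ = Im((· - A 0) w̄₀)`. [folklore] -/
def t₀ (Y : ℂ) : ℝ := ((Y - cA H x₀ 0) * conj (w₀ H x₀)).im

/-- The height is additive. [folklore] -/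
theorem t₀_sub (Y Y' : ℂ) : t₀ H x₀ Y - t₀ H x₀ Y' = ((Y - Y') * conj (w₀ H x₀)).im := by
  simp only [t₀, ← Complex.sub_im]; congr 1; ring

/-- `t₀` is constant along the entry and exit sides. [folklore] -/
theorem t₀_cP (n : ℤ) : t₀ H x₀ (cP H x₀ n) = t₀ H x₀ (cA H x₀ n) := by
  have := t₀_sub H x₀ (cP H x₀ n) (cA H x₀ n)
  rcases entry_vec H x₀ n with h | h
  · rw [h, Complex.mul_conj, Complex.ofReal_im] at this; linarith
  · rw [h, neg_mul, Complex.neg_im, Complex.mul_conj, Complex.ofReal_im, neg_zero] at this; linarith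

/-- The height of the fourth corner. [folklore] -/
theorem t₀_cQ (n : ℤ) : t₀ H x₀ (cQ H x₀ n) = t₀ H x₀ (cB H x₀ n) := by
  have := t₀_sub H x₀ (cQ H x₀ n) (cB H x₀ n)
  rw [exit_vec] at this
  rcases entry_vec H x₀ n with h | h
  · rw [h, neg_mul, Complex.neg_im, Complex.mul_conj, Complex.ofReal_im, neg_zero] at this; linarith
  · rw [h, neg_neg, Complex.mul_conj, Complex.ofReal_im] at this; linarith

/-- The entry height of rhombus `n + 1` is the exit height of rhombus `n`. [folklore] -/
theorem t₀_cA_succ (n : ℤ) : t₀ H x₀ (cA H x₀ (n + 1)) = t₀ H x₀ (cB H x₀ n) := by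
  have hmem : cA H x₀ (n + 1) ∈ ({cB H x₀ n, cQ H x₀ n} : Set ℂ) := by
    rw [← entry_corners_succ]; simp
  rcases hmem with h | h
  · rw [h]
  · rw [mem_singleton_iff] at h; rw [h, t₀_cQ]

/-- `h n` is the transversal increment `t₀ (B n) - t₀ (A n)`. [folklore] -/
theorem hinc_eq (n : ℤ) : hinc H x₀ n = t₀ H x₀ (cB H x₀ n) - t₀ H x₀ (cA H x₀ n) := by
  rw [← t₀_cQ, t₀_sub]; rfl

/-- **The ribbon does not turn back**: consecutive increments have the same sign (rhombus
`n + 1` lies across the exit side of rhombus `n`). [cite: Bruijn1981, §4 (a ribbon proceeds monotonically in the direction normal to its sides)] -/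
theorem hinc_mul_hinc_succ_pos (n : ℤ) : 0 < hinc H x₀ (n + 1) * hinc H x₀ n := by
  have hiso := H.iso
  set d := RhombicEmbedding.refDart (edge H x₀ n) with hd
  set d' := RhombicEmbedding.refDart (edge H x₀ (n + 1)) with hd'
  have hde : d.edge = (edge H x₀ n : Sym2 V) := RhombicEmbedding.refDart_edge _
  have hde' : d'.edge = (edge H x₀ (n + 1) : Sym2 V) := RhombicEmbedding.refDart_edge _
  have hne : d'.edge ≠ d.edge := by
    rw [hde, hde']; exact fun h => edge_succ_ne H x₀ n (Subtype.ext h)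
  have hp : exit H x₀ n ∈ emb.dartSides d := exit_mem H x₀ n
  obtain ⟨hq, hK, -, -, hAB, -⟩ := quad H x₀ n
  obtain ⟨hq', hK', -⟩ := quad H x₀ (n + 1)
  -- the midpoint of the exit side lies in the next rhombus
  set m : ℂ := (cB H x₀ n + cQ H x₀ n) / 2 with hm
  have hm_open : m ∈ openSegment ℝ (emb.z (exit H x₀ n).1) (emb.c (exit H x₀ n).2) :=
    EdgeToEdge.midpoint_mem_openSegment _ _
  have hm' : m ∈ emb.rhombus ⟨d'.edge, d'.edge_mem⟩ := by
    have h1 : (⟨d'.edge, d'.edge_mem⟩ : G.edgeSet) = edge H x₀ (n + 1) := Subtype.ext hde'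
    rw [h1, ← hK']
    have hseg : segment ℝ (cA H x₀ (n + 1)) (cP H x₀ (n + 1)) = segment ℝ (cB H x₀ n) (cQ H x₀ n) :=
      FaultLine.segment_eq_of_pair_eq (entry_corners_succ H x₀ n)
    obtain ⟨hA, hP, -, -⟩ := corners_mem_convexHull_quad (cA H x₀ (n + 1)) (cP H x₀ (n + 1))
      (cB H x₀ (n + 1)) (cQ H x₀ (n + 1))
    have := (convex_convexHull ℝ _).segment_subset hA hP
    rw [hseg] at this
    exact this (openSegment_subset_segment ℝ _ _ hm_open)
  have hout := rhombus_subset_sideOuter hiso H.tiling d d' hne hp hm_open hm'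
  -- the exit-side functional in terms of `t₀`
  have hf : ∀ Y, sideFn (cB H x₀ n) (cQ H x₀ n) Y * sideFn (cB H x₀ n) (cQ H x₀ n) (emb.dartCentre d) =
      -((t₀ H x₀ Y - t₀ H x₀ (cB H x₀ n)) * hinc H x₀ n) / 2 := by
    intro Y
    have hvec := exit_vec H x₀ n
    have hcen : emb.dartCentre d = (cA H x₀ n + cB H x₀ n) / 2 := by
      rw [RhombicEmbedding.dartCentre]
      have h1 : emb.z d.fst + emb.z d.snd = cA H x₀ n + cB H x₀ n := by
        have hA : cA H x₀ n ∈ ({emb.z d.fst, emb.z d.snd} : Set ℂ) := by rw [← hAB]; simp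
        have hB : cB H x₀ n ∈ ({emb.z d.fst, emb.z d.snd} : Set ℂ) := by rw [← hAB]; simp
        have hAB' : cA H x₀ n ≠ cB H x₀ n := hq.A_ne_B
        simp only [mem_insert_iff, mem_singleton_iff] at hA hB
        rcases hA with hA | hA <;> rcases hB with hB | hB
        · exact absurd (hA.trans hB.symm) hAB'
        · rw [hA, hB]
        · rw [hA, hB, add_comm]
        · exact absurd (hA.trans hB.symm) hAB'
      rw [h1]
    have eY : sideFn (cB H x₀ n) (cQ H x₀ n) Y = -(((Y - cB H x₀ n) * conj (cP H x₀ n - cA H x₀ n)).im) := by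
      simp only [sideFn, hvec, map_neg, mul_neg, Complex.neg_im]
    have eM : sideFn (cB H x₀ n) (cQ H x₀ n) (emb.dartCentre d) =
        (((cB H x₀ n - cA H x₀ n) * conj (cP H x₀ n - cA H x₀ n)).im) / 2 := by
      simp only [sideFn, hvec, map_neg, mul_neg, Complex.neg_im, hcen]
      have : ((cA H x₀ n + cB H x₀ n) / 2 - cB H x₀ n) * conj (cP H x₀ n - cA H x₀ n) =
          ((-1 / 2 : ℝ) : ℂ) * ((cB H x₀ n - cA H x₀ n) * conj (cP H x₀ n - cA H x₀ n)) := by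
        push_cast; ring
      rw [this, Complex.im_ofReal_mul]; ring
    have ht : t₀ H x₀ Y - t₀ H x₀ (cB H x₀ n) = ((Y - cB H x₀ n) * conj (w₀ H x₀)).im := t₀_sub H x₀ _ _
    have hh : hinc H x₀ n = ((cB H x₀ n - cA H x₀ n) * conj (w₀ H x₀)).im := by
      rw [hinc_eq, t₀_sub]
    rw [eY, eM, ht, hh]
    rcases entry_vec H x₀ n with h | h
    · rw [h]; ring
    · have hw : w₀ H x₀ = -(cP H x₀ n - cA H x₀ n) := by rw [h, neg_neg]
      rw [hw, map_neg, mul_neg, mul_neg, Complex.neg_im, Complex.neg_im]; ring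
  -- the corner `B (n+1)` of rhombus `n + 1` is in the outer half-plane
  have hBmem : cB H x₀ (n + 1) ∈ emb.rhombus ⟨d'.edge, d'.edge_mem⟩ := by
    have h1 : (⟨d'.edge, d'.edge_mem⟩ : G.edgeSet) = edge H x₀ (n + 1) := Subtype.ext hde'
    rw [h1, ← hK']
    exact (corners_mem_convexHull_quad _ _ _ _).2.2.1
  have h1 := hout hBmem
  change sideFn (cB H x₀ n) (cQ H x₀ n) (cB H x₀ (n + 1)) *
    sideFn (cB H x₀ n) (cQ H x₀ n) (emb.dartCentre d) ≤ 0 at h1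
  rw [hf] at h1
  have h2 : 0 ≤ (t₀ H x₀ (cB H x₀ (n + 1)) - t₀ H x₀ (cB H x₀ n)) * hinc H x₀ n := by linarith
  have h3 : t₀ H x₀ (cB H x₀ (n + 1)) - t₀ H x₀ (cB H x₀ n) = hinc H x₀ (n + 1) := by
    rw [hinc_eq, t₀_cA_succ]
  rw [h3] at h2
  rcases h2.lt_or_eq with h | h
  · exact h
  · exfalso
    rcases mul_eq_zero.1 h.symm with h0 | h0
    · exact hinc_ne_zero H x₀ (n + 1) h0
    · exact hinc_ne_zero H x₀ n h0

/-- All increments have the sign of `h 0`. [folklore] -/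
theorem hinc_mul_hinc_zero_pos (n : ℤ) : 0 < hinc H x₀ n * hinc H x₀ 0 := by
  induction n using Int.induction_on with
  | zero => exact mul_self_pos.2 (hinc_ne_zero H x₀ 0)
  | succ n ih =>
    have h1 := hinc_mul_hinc_succ_pos H x₀ n
    have hn : hinc H x₀ n ≠ 0 := hinc_ne_zero H x₀ n
    have : hinc H x₀ (n + 1) * hinc H x₀ 0 =
        (hinc H x₀ (n + 1) * hinc H x₀ n) * (hinc H x₀ n * hinc H x₀ 0) / (hinc H x₀ n * hinc H x₀ n) := by
      field_simp
    rw [this]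
    exact div_pos (mul_pos h1 ih) (mul_self_pos.2 hn)
  | pred n ih =>
    have h1 := hinc_mul_hinc_succ_pos H x₀ (-n - 1)
    rw [sub_add_cancel] at h1
    have hn : hinc H x₀ (-n) ≠ 0 := hinc_ne_zero H x₀ (-n)
    have : hinc H x₀ (-n - 1) * hinc H x₀ 0 =
        (hinc H x₀ (-n) * hinc H x₀ (-n - 1)) * (hinc H x₀ (-n) * hinc H x₀ 0) /
          (hinc H x₀ (-n) * hinc H x₀ (-n)) := by
      field_simp
    rw [this]
    exact div_pos (mul_pos h1 ih) (mul_self_pos.2 hn)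

/-- The orientation sign `s = ±1` making the increments positive. [folklore] -/
def sgn : ℝ := if 0 < hinc H x₀ 0 then 1 else -1

/-- The orientation sign squares to one. [folklore] -/
theorem sgn_sq : sgn H x₀ * sgn H x₀ = 1 := by
  unfold sgn; split_ifs <;> norm_num

/-- The orientation sign is `±1`. [folklore] -/
theorem sgn_eq_or : sgn H x₀ = 1 ∨ sgn H x₀ = -1 := by
  unfold sgn; split_ifs
  · exact Or.inl rfl
  · exact Or.inr rfl

/-- `s · h n = |h n| > 0`. [folklore] -/
theorem sgn_mul_hinc (n : ℤ) : sgn H x₀ * hinc H x₀ n = |hinc H x₀ n| := by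
  have h := hinc_mul_hinc_zero_pos H x₀ n
  unfold sgn; split_ifs with h0
  · rw [one_mul, abs_of_pos (pos_of_mul_pos_left h h0.le)]
  · push Not at h0
    have h0' : hinc H x₀ 0 < 0 := lt_of_le_of_ne h0 (hinc_ne_zero H x₀ 0)
    have : hinc H x₀ n < 0 := by
      by_contra hc; push Not at hc
      nlinarith [mul_nonpos_of_nonneg_of_nonpos hc h0'.le]
    rw [abs_of_neg this]; ring

/-- The oriented unit vector `w = s · w₀` of the strip. [folklore] -/
def w : ℂ := (sgn H x₀ : ℂ) * w₀ H x₀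

/-- The (signed) shared direction is a unit vector. [folklore] -/
theorem norm_w : ‖w H x₀‖ = 1 := by
  rw [w, norm_mul, Complex.norm_real, norm_w₀, mul_one, Real.norm_eq_abs]
  rcases sgn_eq_or H x₀ with h | h <;> rw [h] <;> norm_num

/-- `P n - A n = ± w`. [folklore] -/
theorem entry_vec_w (n : ℤ) : cP H x₀ n - cA H x₀ n = w H x₀ ∨ cP H x₀ n - cA H x₀ n = -w H x₀ := by
  rcases entry_vec H x₀ n with h | h <;> rcases sgn_eq_or H x₀ with hs | hs <;>
    simp only [w, hs, h] <;> push_cast <;> simp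

/-- The lower corner `L n` of the entry side: the endpoint `E` with `E + w` the other endpoint.
[cite: Bruijn1981, §4 (ribbons of a rhombic tiling)] -/
def L (n : ℤ) : ℂ := if cP H x₀ n - cA H x₀ n = w H x₀ then cA H x₀ n else cP H x₀ n

/-- The two cases for `L n`. [folklore] -/
theorem L_spec (n : ℤ) :
    (L H x₀ n = cA H x₀ n ∧ L H x₀ n + w H x₀ = cP H x₀ n ∧ cP H x₀ n - cA H x₀ n = w H x₀) ∨
    (L H x₀ n = cP H x₀ n ∧ L H x₀ n + w H x₀ = cA H x₀ n ∧ cP H x₀ n - cA H x₀ n = -w H x₀) := by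
  unfold L
  split_ifs with h
  · left; exact ⟨rfl, by rw [← h]; ring, h⟩
  · right
    rcases entry_vec_w H x₀ n with h' | h'
    · exact absurd h' h
    · exact ⟨rfl, by rw [show w H x₀ = -(cP H x₀ n - cA H x₀ n) by rw [h', neg_neg]]; ring, h'⟩

/-- The entry side is `{L n, L n + w}` as a point set. [folklore] -/
theorem pair_L (n : ℤ) : ({L H x₀ n, L H x₀ n + w H x₀} : Set ℂ) = {cA H x₀ n, cP H x₀ n} := by
  rcases L_spec H x₀ n with ⟨h1, h2, -⟩ | ⟨h1, h2, -⟩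
  · rw [h1]; nth_rewrite 2 [← h1]; rw [h2]
  · rw [h1]; nth_rewrite 2 [← h1]; rw [h2, Set.pair_comm]

/-- The shared direction is nonzero. [folklore] -/
theorem w_ne_zero : w H x₀ ≠ 0 := by
  intro h; have := norm_w H x₀; rw [h, norm_zero] at this; exact zero_ne_one this

/-- **The lateral step**: `L (n+1) - L n = Q n - A n` (the lower corners of consecutive shared
sides are joined by a lateral side of the rhombus). [folklore] -/
theorem L_succ_sub (n : ℤ) : L H x₀ (n + 1) - L H x₀ n = cQ H x₀ n - cA H x₀ n := by
  have hq := (quad H x₀ n).1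
  have hsum := hq.sum
  have hw0 := w_ne_zero H x₀
  -- `L (n+1) ∈ {B n, Q n}` with `L (n+1) + w ∈ {B n, Q n}`
  have hL1 : L H x₀ (n + 1) ∈ ({cB H x₀ n, cQ H x₀ n} : Set ℂ) := by
    rw [← entry_corners_succ, ← pair_L]; simp
  have hL2 : L H x₀ (n + 1) + w H x₀ ∈ ({cB H x₀ n, cQ H x₀ n} : Set ℂ) := by
    rw [← entry_corners_succ, ← pair_L]; simp
  simp only [mem_insert_iff, mem_singleton_iff] at hL1 hL2
  rcases L_spec H x₀ n with ⟨h1, -, h3⟩ | ⟨h1, -, h3⟩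
  · -- `w = P - A`, so `Q + w = B` and `L (n+1) = Q`
    rw [h1]
    rcases hL1 with h | h
    · exfalso
      rw [h, ← h3] at hL2
      rcases hL2 with h' | h'
      · exact hw0 (by rw [← h3]; linear_combination h')
      · exact hq.A_ne_P (by linear_combination (-1 / 2 : ℂ) * h' + (-1 / 2 : ℂ) * hsum)
    · rw [h]
  · -- `w = A - P`, so `B + w = Q` and `L (n+1) = B`
    rw [h1]
    rcases hL1 with h | h
    · rw [h]; linear_combination (-1 : ℂ) * hsum
    · exfalso
      have hw : w H x₀ = -(cP H x₀ n - cA H x₀ n) := by rw [h3, neg_neg]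
      rw [h, hw] at hL2
      rcases hL2 with h' | h'
      · exact hq.A_ne_P (by linear_combination (1 / 2 : ℂ) * h' + (-1 / 2 : ℂ) * hsum)
      · exact hw0 (by rw [hw]; linear_combination h')

/-- **The strip data of the ribbon** through `x₀`. [cite: Bruijn1981, §4 (ribbons of a rhombic tiling)] -/
def stripData : StripData where
  w := w H x₀
  L := L H x₀
  η := 2 * (Real.sin ε * Real.sin ε)
  norm_w := norm_w H x₀
  norm_step n := by rw [L_succ_sub, norm_sub_rev]; exact (quad H x₀ n).1.norm_AQ
  η_pos := by
    have hs : 0 < Real.sin ε :=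
      sin_pos_of_hasBoundedAngles H.bap H.pos (RhombicEmbedding.refDart (edge H x₀ 0))
    positivity
  gap n := by
    have key : ((L H x₀ (n + 1) - L H x₀ 0) * (starRingEnd ℂ) (w H x₀)).im -
        ((L H x₀ n - L H x₀ 0) * (starRingEnd ℂ) (w H x₀)).im = |hinc H x₀ n| := by
      rw [← Complex.sub_im]
      have : (L H x₀ (n + 1) - L H x₀ 0) * conj (w H x₀) - (L H x₀ n - L H x₀ 0) * conj (w H x₀) =
          (L H x₀ (n + 1) - L H x₀ n) * conj (w H x₀) := by ring
      rw [this, L_succ_sub, w, map_mul, Complex.conj_ofReal]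
      have : (cQ H x₀ n - cA H x₀ n) * (↑(sgn H x₀) * conj (w₀ H x₀)) =
          (sgn H x₀ : ℂ) * ((cQ H x₀ n - cA H x₀ n) * conj (w₀ H x₀)) := by ring
      rw [this, Complex.im_ofReal_mul]
      exact sgn_mul_hinc H x₀ n
    have := eta_le_abs_hinc H x₀ n
    linarith

/-- The strip of a ribbon has direction `w`. [folklore] -/
theorem stripData_w : (stripData H x₀).w = w H x₀ := rfl
/-- The strip of a ribbon has lower corners `L`. [folklore] -/
theorem stripData_L (n : ℤ) : (stripData H x₀).L n = L H x₀ n := rfl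

/-- **The rhombi of the strip are the rhombi of the ribbon.** [cite: Bruijn1981, §4 (ribbons of a rhombic tiling)] -/
theorem hull_eq_rhombus (n : ℤ) : (stripData H x₀).hull n = emb.rhombus (edge H x₀ n) := by
  obtain ⟨hq, hK, -⟩ := quad H x₀ n
  rw [StripData.hull, stripData_w, stripData_L, stripData_L, ← hK]
  have hstep := L_succ_sub H x₀ n
  have hsum := hq.sum
  congr 1
  rcases L_spec H x₀ n with ⟨h1, h2, h3⟩ | ⟨h1, h2, h3⟩
  · -- `L n = A`, `L n + w = P`, `L (n+1) = Q`, `L (n+1) + w = B`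
    have hL1 : L H x₀ (n + 1) = cQ H x₀ n := by linear_combination hstep + h1
    have hL1w : L H x₀ (n + 1) + w H x₀ = cB H x₀ n := by
      rw [hL1, ← h3]; linear_combination hsum
    rw [h2, hL1w, hL1, h1]
  · -- `L n = P`, `L n + w = A`, `L (n+1) = B`, `L (n+1) + w = Q`
    have hL1 : L H x₀ (n + 1) = cB H x₀ n := by
      have : L H x₀ (n + 1) = cQ H x₀ n - cA H x₀ n + cP H x₀ n := by linear_combination hstep + h1
      rw [this]; linear_combination hsum
    have hw : w H x₀ = cA H x₀ n - cP H x₀ n := by linear_combination h3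
    have hL1w : L H x₀ (n + 1) + w H x₀ = cQ H x₀ n := by
      rw [hL1, hw]; linear_combination (-1 : ℂ) * hsum
    rw [h2, hL1w, hL1, h1]
    ext X; simp only [mem_insert_iff, mem_singleton_iff]; tauto

/-- The longitudinal coordinate at the entry corners: `{a (A n), a (P n)} = {0, 1}`, and the
lateral pairs agree: `a (A n) = a (Q n)`, `a (P n) = a (B n)`. [folklore] -/
theorem a_corners (n : ℤ) :
    ((stripData H x₀).a (cA H x₀ n) = 0 ∧ (stripData H x₀).a (cP H x₀ n) = 1 ∧
      (stripData H x₀).a (cQ H x₀ n) = 0 ∧ (stripData H x₀).a (cB H x₀ n) = 1) ∨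
    ((stripData H x₀).a (cA H x₀ n) = 1 ∧ (stripData H x₀).a (cP H x₀ n) = 0 ∧
      (stripData H x₀).a (cQ H x₀ n) = 1 ∧ (stripData H x₀).a (cB H x₀ n) = 0) := by
  set D := stripData H x₀ with hD
  have ha0 : ∀ m, D.a (L H x₀ m) = 0 := fun m => D.a_L m
  have ha1 : ∀ m, D.a (L H x₀ m + w H x₀) = 1 := fun m => D.a_L_add_w m
  have hstep := L_succ_sub H x₀ n
  have hsum := (quad H x₀ n).1.sum
  rcases L_spec H x₀ n with ⟨h1, h2, h3⟩ | ⟨h1, h2, h3⟩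
  · left
    have hL1 : L H x₀ (n + 1) = cQ H x₀ n := by linear_combination hstep + h1
    have hL1w : L H x₀ (n + 1) + w H x₀ = cB H x₀ n := by
      rw [hL1, ← h3]; linear_combination hsum
    refine ⟨by rw [← h1]; exact ha0 n, by rw [← h2]; exact ha1 n, by rw [← hL1]; exact ha0 (n + 1),
      by rw [← hL1w]; exact ha1 (n + 1)⟩
  · right
    have hL1 : L H x₀ (n + 1) = cB H x₀ n := by
      have : L H x₀ (n + 1) = cQ H x₀ n - cA H x₀ n + cP H x₀ n := by linear_combination hstep + h1
      rw [this]; linear_combination hsum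
    have hw : w H x₀ = cA H x₀ n - cP H x₀ n := by linear_combination h3
    have hL1w : L H x₀ (n + 1) + w H x₀ = cQ H x₀ n := by
      rw [hL1, hw]; linear_combination (-1 : ℂ) * hsum
    refine ⟨by rw [← h2]; exact ha1 n, by rw [← h1]; exact ha0 n, by rw [← hL1w]; exact ha1 (n + 1),
      by rw [← hL1]; exact ha0 (n + 1)⟩

/-- **A rhombus not on the ribbon lies on one side of it.** [cite: Bruijn1981, §4 (a ribbon separates the plane)] -/
theorem rhombus_subset_or_subset {e' : G.edgeSet} (he' : e' ∉ Set.range (edge H x₀)) :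
    emb.rhombus e' ⊆ {Y | (stripData H x₀).a Y ≤ 0} ∨ emb.rhombus e' ⊆ {Y | 1 ≤ (stripData H x₀).a Y} := by
  set d := RhombicEmbedding.refDart e' with hd
  have hde : (⟨d.edge, d.edge_mem⟩ : G.edgeSet) = e' := Subtype.ext (RhombicEmbedding.refDart_edge e')
  have hq := dart_isQuad H.iso d
  have hK : emb.rhombus e' = convexHull ℝ {emb.z d.fst, emb.c (emb.leftFace d), emb.z d.snd,
      emb.c (emb.rightFace d)} := by rw [← hde]; exact rhombus_dart_eq H.iso d
  apply (stripData H x₀).subset_or_subset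
  · rw [hK]; exact subset_closure_interior_quad hq
  · rw [hK]; exact (convex_convexHull ℝ _).interior
  · intro n
    rw [hull_eq_rhombus, Set.eq_empty_iff_forall_notMem]
    rintro Y ⟨hY, hYn⟩
    have hne : e' ≠ edge H x₀ n := fun h => he' ⟨n, h.symm⟩
    obtain ⟨hqn, hKn, -⟩ := quad H x₀ n
    rw [← hKn] at hYn
    have hmeet := interior_inter_nonempty hqn hYn hY
    rw [hKn] at hmeet
    exact Set.not_nonempty_iff_eq_empty.2
      (Set.disjoint_iff_inter_eq_empty.1 (H.tiling.disjoint_interior hne.symm)) hmeet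

/-- Across the exit side lies the next rhombus of the ribbon. [cite: GrimmettManolescu2014Isoradial, §4.2 (a track is a doubly infinite sequence of rhombi)] -/
theorem acrossEdge_exit (n : ℤ) : acrossEdge H (edge H x₀ n) (exit H x₀ n) = edge H x₀ (n + 1) :=
  (edge_succ H x₀ n).symm

/-- Across the entry side lies the previous rhombus of the ribbon. [cite: GrimmettManolescu2014Isoradial, §4.2 (a track is a doubly infinite sequence of rhombi)] -/
theorem acrossEdge_entry (n : ℤ) : acrossEdge H (edge H x₀ n) (entry H x₀ n) = edge H x₀ (n - 1) := by
  have h1 : edge H x₀ n = acrossEdge H (edge H x₀ (n - 1)) (exit H x₀ (n - 1)) := by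
    have := edge_succ H x₀ (n - 1); rw [sub_add_cancel] at this; exact this
  have hmem : entry H x₀ n ∈ emb.sides (acrossEdge H (edge H x₀ (n - 1)) (exit H x₀ (n - 1))) := by
    rw [← h1]; exact entry_mem H x₀ n
  have hpair : ({emb.z (entry H x₀ n).1, emb.c (entry H x₀ n).2} : Set ℂ) =
      {emb.z (exit H x₀ (n - 1)).1, emb.c (exit H x₀ (n - 1)).2} := by
    have := entry_pair_succ H x₀ (n - 1); rw [sub_add_cancel] at this; exact this
  have := acrossEdge_acrossEdge H (edge H x₀ (n - 1)) (exit_mem H x₀ (n - 1)) hmem hpair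
  rw [← h1] at this
  exact this

/-- **The rhombus across a lateral side is not on the ribbon** (it has interior points in the
slab of rhombus `n` outside rhombus `n`, while the strip meets that open slab only in rhombus `n`).
Hence each rhombus lies on exactly two ribbons. [cite: GrimmettManolescu2014Isoradial, §4.2 (each rhombus belongs to exactly two tracks)] -/
theorem acrossEdge_lateral_not_mem (n : ℤ) {s : V × F} (hs : s ∈ emb.sides (edge H x₀ n))
    (hs1 : s ≠ entry H x₀ n) (hs2 : s ≠ exit H x₀ n) :
    acrossEdge H (edge H x₀ n) s ∉ Set.range (edge H x₀) := by
  rintro ⟨m, hm⟩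
  set D := stripData H x₀ with hD
  set U := acrossEdge H (edge H x₀ n) s with hU
  have hUne : U ≠ edge H x₀ n := acrossEdge_ne H _ hs
  obtain ⟨hq, hK, -⟩ := quad H x₀ n
  -- the lateral side `s` is `[A, Q]` or `[B, P]`
  have hlat : ({emb.z s.1, emb.c s.2} : Set ℂ) = {cA H x₀ n, cQ H x₀ n} ∨
      ({emb.z s.1, emb.c s.2} : Set ℂ) = {cB H x₀ n, cP H x₀ n} := by
    rcases (mem_sides_iff_of_mem H.iso (edge H x₀ n) (entry_mem H x₀ n) s).1 hs with h | h | h | h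
    · exact absurd h hs1
    · rw [oppositeSide_entry] at h; exact absurd h hs2
    · left; rw [h, oppositeSide_entry]; rfl
    · right; rw [h, oppositeSide_entry]; rfl
  -- its midpoint `M`, with `t M` in the open slab
  obtain ⟨E₁, E₂, hE, htE₁, htE₂, hEU⟩ : ∃ E₁ E₂ : ℂ, ({emb.z s.1, emb.c s.2} : Set ℂ) = {E₁, E₂} ∧
      D.t E₁ = D.tn n ∧ D.t E₂ = D.tn (n + 1) ∧ segment ℝ E₁ E₂ ⊆ emb.rhombus U := by
    have hsegU : segment ℝ (emb.z s.1) (emb.c s.2) ⊆ emb.rhombus U := by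
      obtain ⟨p', hp', hs'⟩ := exists_side_acrossEdge H (edge H x₀ n) hs
      rw [← FaultLine.segment_eq_of_pair_eq hs', ← rhombus_refDart]
      exact FaultLine.segment_side_subset_rhombus H.iso hp'
    -- `t` at the four corners
    have htA : D.t (cA H x₀ n) = D.tn n := by
      have : cA H x₀ n ∈ ({L H x₀ n, L H x₀ n + w H x₀} : Set ℂ) := by rw [pair_L]; simp
      rcases this with h | h
      · rw [h]; rfl
      · rw [mem_singleton_iff] at h; rw [h]; exact D.t_L_add_w n
    have htP : D.t (cP H x₀ n) = D.tn n := by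
      have : cP H x₀ n ∈ ({L H x₀ n, L H x₀ n + w H x₀} : Set ℂ) := by rw [pair_L]; simp
      rcases this with h | h
      · rw [h]; rfl
      · rw [mem_singleton_iff] at h; rw [h]; exact D.t_L_add_w n
    have htB : D.t (cB H x₀ n) = D.tn (n + 1) := by
      have : cB H x₀ n ∈ ({L H x₀ (n + 1), L H x₀ (n + 1) + w H x₀} : Set ℂ) := by
        rw [pair_L, entry_corners_succ]; simp
      rcases this with h | h
      · rw [h]; rfl
      · rw [mem_singleton_iff] at h; rw [h]; exact D.t_L_add_w (n + 1)
    have htQ : D.t (cQ H x₀ n) = D.tn (n + 1) := by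
      have : cQ H x₀ n ∈ ({L H x₀ (n + 1), L H x₀ (n + 1) + w H x₀} : Set ℂ) := by
        rw [pair_L, entry_corners_succ]; simp
      rcases this with h | h
      · rw [h]; rfl
      · rw [mem_singleton_iff] at h; rw [h]; exact D.t_L_add_w (n + 1)
    rcases hlat with h | h
    · refine ⟨cA H x₀ n, cQ H x₀ n, h, htA, htQ, ?_⟩
      rw [← FaultLine.segment_eq_of_pair_eq h]; exact hsegU
    · refine ⟨cP H x₀ n, cB H x₀ n, by rw [h, Set.pair_comm], htP, htB, ?_⟩
      rw [segment_symm, ← FaultLine.segment_eq_of_pair_eq h]; exact hsegU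
  set M : ℂ := (E₁ + E₂) / 2 with hM
  have hMU : M ∈ emb.rhombus U := hEU (openSegment_subset_segment ℝ _ _
    (EdgeToEdge.midpoint_mem_openSegment E₁ E₂))
  have htM : D.t M = (D.tn n + D.tn (n + 1)) / 2 := by
    have : M = (1 / 2 : ℝ) • E₁ + (1 / 2 : ℝ) • E₂ := by
      simp only [hM, Complex.real_smul]; push_cast; ring
    rw [this, StripData.t, sideFn_combo _ _ _ _ (by norm_num : (1 / 2 : ℝ) + 1 / 2 = 1)]
    change 1 / 2 * D.t E₁ + 1 / 2 * D.t E₂ = _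
    rw [htE₁, htE₂]; ring
  have hΔ : 0 < D.tn (n + 1) - D.tn n := sub_pos.2 (D.tn_strictMono (lt_add_one n))
  -- an interior point `Y` of `U` close to `M`
  set dU := RhombicEmbedding.refDart U with hdU
  have hqU := dart_isQuad H.iso dU
  have hKU : emb.rhombus U = convexHull ℝ {emb.z dU.fst, emb.c (emb.leftFace dU), emb.z dU.snd,
      emb.c (emb.rightFace dU)} := by rw [← rhombus_refDart]; exact rhombus_dart_eq H.iso dU
  have hcl : M ∈ closure (interior (emb.rhombus U)) := by
    rw [hKU] at hMU ⊢; exact subset_closure_interior_quad hqU hMU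
  rw [Metric.mem_closure_iff] at hcl
  obtain ⟨Y, hYint, hYdist⟩ := hcl ((D.tn (n + 1) - D.tn n) / 2) (by linarith)
  -- `Y` lies in the open slab `n`
  have htY : D.tn n < D.t Y ∧ D.t Y < D.tn (n + 1) := by
    have h1 := D.abs_t_sub_t_le Y M
    rw [dist_comm, dist_eq_norm] at hYdist
    have h2 : |D.t Y - D.t M| < (D.tn (n + 1) - D.tn n) / 2 := lt_of_le_of_lt h1 hYdist
    rw [htM, abs_lt] at h2
    constructor <;> linarith [h2.1, h2.2]
  -- `Y ∈ rhombus (edge m) = hull m ⊆ {0 ≤ a ≤ 1}`, hence `Y ∈ hull (idx (t Y)) = hull n = rhombus n`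
  have hYm : Y ∈ D.hull m := by rw [hull_eq_rhombus, hm]; exact interior_subset hYint
  obtain ⟨-, ha0, ha1⟩ := D.hull_subset m hYm
  have hYn : Y ∈ D.hull n := by
    have := D.mem_hull_idx ha0 ha1
    rwa [D.idx_eq_iff.2 ⟨htY.1.le, htY.2⟩] at this
  rw [hull_eq_rhombus, ← hK] at hYn
  -- so the interiors of `U` and `edge n` meet
  have hmeet := interior_inter_nonempty hq hYn hYint
  rw [hK] at hmeet
  exact Set.not_nonempty_iff_eq_empty.2
    (Set.disjoint_iff_inter_eq_empty.1 (H.tiling.disjoint_interior hUne.symm)) hmeet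

end Shape

end Ribbon

end Literature.Probability.Percolation

end

/-!
# Planarity of rhombic tilings, VIII: the parity colouring and corner consistency

Topic `Literature/Probability/Percolation`. **Main theorem** (`z_ne_c_leftFace`,
`cornerConsistent`): for a preconnected graph `G`, isoradially embedded with the tiling
condition and bounded angles (`PlanarTilingHyps`), **no vertex of `G` is drawn at the centre of
a face of a rhombus**: `emb.z v ≠ emb.c (emb.leftFace d)` for every vertex `v` and dart `d`.
This is the *corner consistency* / *proper two-colouring of the corners of `G^◇`* ("vertex of
`G`" versus "vertex of `G*`") that Grimmett–Manolescu (PTRF 159 (2014) = arXiv:1204.0505, §2.1,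
§4.1) and Kenyon–Schlenker (2005) build into the definition of a rhombic tiling as the diamond
graph of a planar graph, and which the tree's rendering `IsRhombicTiling` does not record; it
is the hypothesis `hcons`/`hclash` of the planar-duality files (`IsoradialDualCrossings`,
`IsoradialDualityExclusion`). Without connectedness it fails (relabel a half-plane of `ℤ²`).

Proof (de Bruijn's ribbons as separators). Fix a base corner `P₀ = z x₀`. Every ribbon `R`
(file VII) is a strip (file VI) with a continuous longitudinal coordinate `a_R`; every corner of
every rhombus lies in `{a_R ≤ 0}` or in `{1 ≤ a_R}` (`corner_dichotomy`). Let `Sep(C)` be the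
set of ribbons having `P₀` and the corner `C` on different sides; it is finite (a segment from
one side to the other meets the strip, in one of the finitely many rhombi near the segment, and
a ribbon is determined by any of its rhombi together with one of its four sides). For the two
endpoints `C₁, C₂` of a side `s` of a rhombus `T`, `Sep(C₁) ∆ Sep(C₂)` is exactly the one ribbon
through `T` crossing `s` (`flipSet_eq_singleton`: a ribbon not containing `T` has `T` on one
side; the ribbon through `T` crossing its other pair of sides has the endpoints of `s` on the
same boundary; the ribbon across a lateral side of a rhombus of a ribbon is not that ribbon).
Hence the parity `χ(C)` of `|Sep(C)|` flips across every side, so it agrees on the two vertex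
corners of each rhombus and differs on its face corners; along edges of `G` it is constant on
vertices, hence (connectedness) `χ(z v) = χ(P₀) = 0` for all `v`, while `χ(c f) = 1` for every
face corner: a vertex position is never a face-centre position.

## References

* N. G. de Bruijn, *Algebraic theory of Penrose's non-periodic tilings of the plane*, Indag.
  Math. 43 (1981), §4 (ribbons; the parity/pentagrid structure).
* G. R. Grimmett, I. Manolescu, *Bond percolation on isoradial graphs*, PTRF 159 (2014),
  arXiv:1204.0505, §2.1, §4.1–4.2.
* R. Kenyon, J.-M. Schlenker, *Rhombic embeddings of planar quad-graphs*, TAMS 357 (2005), §3.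
-/

noncomputable section

open Complex ComplexConjugate Metric Set Filter Topology

namespace Literature.Probability.Percolation

open Literature.Probability.LatticeModels IsoradialCriticality

variable {V F : Type*} {G : SimpleGraph V} {emb : RhombicEmbedding G F} {ε : ℝ}
variable [DecidableEq V] [DecidableEq F]

namespace Parity

variable (H : PlanarTilingHyps emb ε)

/-! ### Ribbons as sets of edges, their chosen strips -/

/-- The set of **ribbons** (as sets of edges). [cite: Bruijn1981, §4 (ribbons of a rhombic tiling)] -/
def Rib : Set (Set G.edgeSet) := {R | ∃ x₀ : Ribbon.St emb, R = Set.range (Ribbon.edge H x₀)}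

/-- The range of a ribbon is one of the ribbons. [folklore] -/
theorem range_mem_Rib (x₀ : Ribbon.St emb) : Set.range (Ribbon.edge H x₀) ∈ Rib H := ⟨x₀, rfl⟩

/-- A chosen base state of a ribbon. [folklore] -/
def pres {R : Set G.edgeSet} (hR : R ∈ Rib H) : Ribbon.St emb := Classical.choose hR

/-- The chosen presentation presents the ribbon. [folklore] -/
theorem range_pres {R : Set G.edgeSet} (hR : R ∈ Rib H) :
    Set.range (Ribbon.edge H (pres H hR)) = R := (Classical.choose_spec hR).symm

open Classical in
/-- The longitudinal coordinate of (the chosen strip of) a ribbon (`0` off `Rib`). [folklore] -/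
def aR (R : Set G.edgeSet) (Y : ℂ) : ℝ :=
  if hR : R ∈ Rib H then (Ribbon.stripData H (pres H hR)).a Y else 0

/-- The coordinate of a ribbon does not depend on the presentation used to name it. [folklore] -/
theorem aR_eq {R : Set G.edgeSet} (hR : R ∈ Rib H) (Y : ℂ) :
    aR H R Y = (Ribbon.stripData H (pres H hR)).a Y := by
  rw [aR, dif_pos hR]

/-! ### Corners -/

/-- The corner set of the rhombus of a dart. [folklore] -/
def cornerSet (emb : RhombicEmbedding G F) (d : G.Dart) : Set ℂ :=
  {emb.z d.fst, emb.c (emb.leftFace d), emb.z d.snd, emb.c (emb.rightFace d)}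

omit [DecidableEq V] [DecidableEq F] in
/-- Membership in the corner set of a dart, unfolded. [folklore] -/
theorem mem_cornerSet_iff (d : G.Dart) (C : ℂ) : C ∈ cornerSet emb d ↔
    C = emb.z d.fst ∨ C = emb.c (emb.leftFace d) ∨ C = emb.z d.snd ∨ C = emb.c (emb.rightFace d) := by
  simp [cornerSet]

omit [DecidableEq V] [DecidableEq F] in
/-- Darts with the same edge have the same corner set. [folklore] -/
theorem cornerSet_eq_of_edge_eq (hiso : emb.IsIsoradial) {d d' : G.Dart} (h : d.edge = d'.edge) :
    cornerSet emb d = cornerSet emb d' := by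
  rcases (SimpleGraph.dart_edge_eq_iff d d').1 h with rfl | rfl
  · rfl
  · have hr : emb.rightFace d'.symm = emb.leftFace d' := by
      rw [← hiso.leftFace_symm d'.symm, SimpleGraph.Dart.symm_symm]
    simp only [cornerSet, hiso.leftFace_symm, hr, SimpleGraph.Dart.symm_toProd, Prod.fst_swap,
      Prod.snd_swap]
    apply Set.ext; intro X; simp only [mem_insert_iff, mem_singleton_iff]; tauto

omit [DecidableEq V] [DecidableEq F] in
/-- Corners lie in the rhombus. [folklore] -/
theorem cornerSet_subset_rhombus (hiso : emb.IsIsoradial) (d : G.Dart) :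
    cornerSet emb d ⊆ emb.rhombus ⟨d.edge, d.edge_mem⟩ := by
  rw [rhombus_dart_eq hiso d, cornerSet]
  exact subset_convexHull ℝ _

/-- The corner set of a rhombus of a ribbon, in the ribbon's labels. [folklore] -/
theorem cornerSet_refDart_edge (x₀ : Ribbon.St emb) (n : ℤ) :
    cornerSet emb (RhombicEmbedding.refDart (Ribbon.edge H x₀ n)) =
      {Ribbon.cA H x₀ n, Ribbon.cP H x₀ n, Ribbon.cB H x₀ n, Ribbon.cQ H x₀ n} := by
  obtain ⟨-, -, -, -, hAB, hPQ⟩ := Ribbon.quad H x₀ n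
  have : cornerSet emb (RhombicEmbedding.refDart (Ribbon.edge H x₀ n)) =
      ({emb.z (RhombicEmbedding.refDart (Ribbon.edge H x₀ n)).fst,
        emb.z (RhombicEmbedding.refDart (Ribbon.edge H x₀ n)).snd} : Set ℂ) ∪
      {emb.c (emb.leftFace (RhombicEmbedding.refDart (Ribbon.edge H x₀ n))),
        emb.c (emb.rightFace (RhombicEmbedding.refDart (Ribbon.edge H x₀ n)))} := by
    apply Set.ext; intro X; simp only [cornerSet, mem_insert_iff, mem_singleton_iff, mem_union]; tauto
  rw [this, ← hAB, ← hPQ]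
  apply Set.ext; intro X; simp only [mem_insert_iff, mem_singleton_iff, mem_union]; tauto

/-- **A corner point.** [folklore] -/
def IsCorner (emb : RhombicEmbedding G F) (C : ℂ) : Prop := ∃ d : G.Dart, C ∈ cornerSet emb d

/-- **Corner dichotomy**: every corner lies in `{a_R ≤ 0}` or in `{1 ≤ a_R}`, for every ribbon.
[cite: Bruijn1981, §4 (a ribbon separates the corners of the tiling into two classes)] -/
theorem corner_dichotomy {R : Set G.edgeSet} (hR : R ∈ Rib H) {C : ℂ} (hC : IsCorner emb C) :
    aR H R C ≤ 0 ∨ 1 ≤ aR H R C := by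
  obtain ⟨d, hd⟩ := hC
  rw [aR_eq H hR]
  set y := pres H hR with hy
  by_cases hmem : (⟨d.edge, d.edge_mem⟩ : G.edgeSet) ∈ Set.range (Ribbon.edge H y)
  · obtain ⟨n, hn⟩ := hmem
    have hde : d.edge = (RhombicEmbedding.refDart (Ribbon.edge H y n)).edge := by
      rw [RhombicEmbedding.refDart_edge, hn]
    rw [cornerSet_eq_of_edge_eq H.iso hde, cornerSet_refDart_edge] at hd
    simp only [mem_insert_iff, mem_singleton_iff] at hd
    rcases Ribbon.a_corners H y n with ⟨hA, hP, hQ, hB⟩ | ⟨hA, hP, hQ, hB⟩ <;>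
      rcases hd with rfl | rfl | rfl | rfl <;>
      first
      | (left; exact hA.le) | (right; exact hA.ge) | (left; exact hP.le) | (right; exact hP.ge)
      | (left; exact hB.le) | (right; exact hB.ge) | (left; exact hQ.le) | (right; exact hQ.ge)
  · rcases Ribbon.rhombus_subset_or_subset H y hmem with h | h
    · exact Or.inl (h (cornerSet_subset_rhombus H.iso d hd))
    · exact Or.inr (h (cornerSet_subset_rhombus H.iso d hd))

/-! ### Separating ribbons and their finiteness -/

/-- The ribbons separating the corner `C` from the base corner `P₀`. [cite: Bruijn1981, §4 (ribbons of a rhombic tiling)] -/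
def Sep (P₀ C : ℂ) : Set (Set G.edgeSet) := {R | R ∈ Rib H ∧ ¬ (aR H R P₀ ≤ 0 ↔ aR H R C ≤ 0)}

/-- The states over a fixed edge form a finite set. [folklore] -/
theorem finite_states_over (e : G.edgeSet) : {x : Ribbon.St emb | x.1.1 = e}.Finite := by
  have hinj : Set.InjOn (fun x : Ribbon.St emb => x.1) univ := fun x _ y _ h => Subtype.ext h
  have hfin : (({e} : Set G.edgeSet) ×ˢ ((emb.sides e : Finset (V × F)) : Set (V × F))).Finite :=
    (Set.finite_singleton e).prod (Finset.finite_toSet _)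
  refine (hfin.preimage (hinj.mono (subset_univ _))).subset ?_
  rintro x hx
  simp only [mem_setOf_eq] at hx
  simp only [mem_preimage, mem_prod, mem_singleton_iff, Finset.mem_coe]
  exact ⟨hx, hx ▸ x.2⟩

/-- **Finiteness of the separating set** between two corners. [cite: Bruijn1981, §4 (only finitely many ribbons pass between two points)] -/
theorem Sep_finite {P₀ C : ℂ} (hP₀ : IsCorner emb P₀) (hC : IsCorner emb C) :
    (Sep H P₀ C).Finite := by
  -- the edges whose rhombus meets the segment `[P₀, C]`
  set FinE : Set G.edgeSet := {e' | (emb.rhombus e' ∩ closedBall P₀ ‖C - P₀‖).Nonempty} with hFinE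
  have hFinE_fin : FinE.Finite :=
    finite_setOf_rhombus_inter_closedBall H.iso H.tiling H.bap H.pos P₀ _
  -- every separating ribbon is the ribbon of a state over such an edge
  have hsub : Sep H P₀ C ⊆ ⋃ e' ∈ FinE, (fun x : Ribbon.St emb => Set.range (Ribbon.edge H x)) ''
      {x : Ribbon.St emb | x.1.1 = e'} := by
    rintro R ⟨hR, hsep⟩
    set y := pres H hR with hy
    set D := Ribbon.stripData H y with hD
    -- a point `Z` of the segment in the strip
    obtain ⟨Z, hZseg, hZ0, hZ1⟩ : ∃ Z ∈ segment ℝ P₀ C, 0 ≤ D.a Z ∧ D.a Z ≤ 1 := by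
      rcases corner_dichotomy H hR hP₀ with h0 | h0 <;> rcases corner_dichotomy H hR hC with h1 | h1
      · exact absurd ⟨fun _ => h1, fun _ => h0⟩ hsep
      · rw [aR_eq H hR] at h0 h1; exact D.exists_mem_segment h0 h1
      · rw [aR_eq H hR] at h0 h1; exact D.exists_mem_segment' h0 h1
      · rw [aR_eq H hR] at h0 h1
        exfalso; apply hsep
        rw [aR_eq H hR, aR_eq H hR]
        constructor <;> intro h <;> linarith
    have hZk := D.mem_hull_idx hZ0 hZ1
    set k := D.idx (D.t Z) with hk
    rw [hD, Ribbon.hull_eq_rhombus] at hZk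
    set e' := Ribbon.edge H y k with he'
    have he'Fin : e' ∈ FinE := by
      refine ⟨Z, hZk, ?_⟩
      rw [mem_closedBall, dist_eq_norm]
      rw [segment_eq_image] at hZseg
      obtain ⟨θ, ⟨hθ0, hθ1⟩, rfl⟩ := hZseg
      have : (1 - θ) • P₀ + θ • C - P₀ = θ • (C - P₀) := by
        simp only [Complex.real_smul]; push_cast; ring
      rw [this, norm_smul, Real.norm_eq_abs, abs_of_nonneg hθ0]
      exact mul_le_of_le_one_left (norm_nonneg _) hθ1
    refine mem_biUnion he'Fin ⟨Ribbon.seq H y k, rfl, ?_⟩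
    show Set.range (Ribbon.edge H (Ribbon.seq H y k)) = R
    rw [Ribbon.range_edge_seq, hy, range_pres]
  exact (hFinE_fin.biUnion fun e' _ => (finite_states_over e').image _).subset hsub

/-! ### The flip across a side -/

/-- The ribbons having the two endpoints of a side on different sides: the symmetric difference
of the separating sets. [folklore] -/
theorem Sep_symmDiff (P₀ C₁ C₂ : ℂ) :
    symmDiff (Sep H P₀ C₁) (Sep H P₀ C₂) = {R | R ∈ Rib H ∧ ¬ (aR H R C₁ ≤ 0 ↔ aR H R C₂ ≤ 0)} := by
  ext R
  simp only [Set.mem_symmDiff, Sep, mem_setOf_eq]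
  tauto

/-- The state `(e, s)`. [folklore] -/
def st (e : G.edgeSet) {s : V × F} (hs : s ∈ emb.sides e) : Ribbon.St emb := ⟨(e, s), hs⟩

/-- **The flip set of a side is the single ribbon crossing it.** For a side `s` of the rhombus
of `e`, the ribbons having its endpoints `z s.1`, `c s.2` on different sides are exactly the
ribbon through `(e, s)`. [cite: Bruijn1981, §4 (each side is crossed by exactly one ribbon)] -/
theorem flipSet_eq_singleton (e : G.edgeSet) {s : V × F} (hs : s ∈ emb.sides e) :
    {R | R ∈ Rib H ∧ ¬ (aR H R (emb.z s.1) ≤ 0 ↔ aR H R (emb.c s.2) ≤ 0)} =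
      {Set.range (Ribbon.edge H (st e hs))} := by
  set R₀ := Set.range (Ribbon.edge H (st e hs)) with hR₀
  have hR₀mem : R₀ ∈ Rib H := range_mem_Rib H _
  have he0 : Ribbon.edge H (st e hs) 0 = e := by simp [Ribbon.edge, Ribbon.seq_zero, st]
  have he1 : Ribbon.edge H (st e hs) 1 = acrossEdge H e s := by
    have := Ribbon.edge_succ H (st e hs) 0
    rw [zero_add] at this; rw [this, he0]; rfl
  -- key computation inside any ribbon `R ∈ Rib` containing `e = edge y n`
  have key : ∀ {R : Set G.edgeSet} (hR : R ∈ Rib H) (n : ℤ), Ribbon.edge H (pres H hR) n = e →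
      ((s = Ribbon.entry H (pres H hR) n ∨ s = Ribbon.exit H (pres H hR) n) →
        ¬ (aR H R (emb.z s.1) ≤ 0 ↔ aR H R (emb.c s.2) ≤ 0) ∧ R = R₀) ∧
      ((s ≠ Ribbon.entry H (pres H hR) n ∧ s ≠ Ribbon.exit H (pres H hR) n) →
        (aR H R (emb.z s.1) ≤ 0 ↔ aR H R (emb.c s.2) ≤ 0)) := by
    intro R hR n hn
    set y := pres H hR with hy
    have hRy : Set.range (Ribbon.edge H y) = R := range_pres H hR
    have hsn : s ∈ emb.sides (Ribbon.edge H y n) := by rw [hn]; exact hs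
    constructor
    · intro hcase
      constructor
      · rw [aR_eq H hR, aR_eq H hR]
        rcases hcase with rfl | rfl
        · -- entry side: endpoints `A n`, `P n`
          change ¬ ((Ribbon.stripData H y).a (Ribbon.cA H y n) ≤ 0 ↔
            (Ribbon.stripData H y).a (Ribbon.cP H y n) ≤ 0)
          rcases Ribbon.a_corners H y n with ⟨hA, hP, -, -⟩ | ⟨hA, hP, -, -⟩ <;>
            rw [hA, hP] <;> norm_num
        · change ¬ ((Ribbon.stripData H y).a (Ribbon.cB H y n) ≤ 0 ↔
            (Ribbon.stripData H y).a (Ribbon.cQ H y n) ≤ 0)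
          rcases Ribbon.a_corners H y n with ⟨-, -, hQ, hB⟩ | ⟨-, -, hQ, hB⟩ <;>
            rw [hB, hQ] <;> norm_num
      · -- `R = R₀`
        have hseq : Set.range (Ribbon.edge H (Ribbon.seq H y n)) = R := by
          rw [Ribbon.range_edge_seq, hRy]
        have hval : (Ribbon.seq H y n).1 = (e, Ribbon.exit H y n) := by
          rw [← hn]; rfl
        rcases hcase with hc | hc
        · -- `s = entry n`: `st e hs = flip (seq y n)`
          have hflip : st e hs = Ribbon.flip (Ribbon.seq H y n) := by
            apply Subtype.ext
            change (e, s) = ((Ribbon.seq H y n).1.1,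
              emb.oppositeSide (Ribbon.seq H y n).1.1 (Ribbon.seq H y n).1.2)
            rw [hval, hc]
            change (e, emb.oppositeSide (Ribbon.edge H y n) (Ribbon.exit H y n)) =
              (e, emb.oppositeSide e (Ribbon.exit H y n))
            rw [hn]
          rw [← hseq, hR₀, hflip, Ribbon.range_edge_flip]
        · have hst : st e hs = Ribbon.seq H y n := by
            apply Subtype.ext
            rw [hval]
            show (e, s) = (e, Ribbon.exit H y n)
            rw [hc]
          rw [← hseq, hR₀, hst]
    · rintro ⟨h1, h2⟩
      rw [aR_eq H hR, aR_eq H hR]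
      rcases (mem_sides_iff_of_mem H.iso _ (Ribbon.entry_mem H y n) s).1 hsn with h | h | h | h
      · exact absurd h h1
      · rw [Ribbon.oppositeSide_entry] at h; exact absurd h h2
      · rw [h, Ribbon.oppositeSide_entry]
        change (Ribbon.stripData H y).a (Ribbon.cA H y n) ≤ 0 ↔
          (Ribbon.stripData H y).a (Ribbon.cQ H y n) ≤ 0
        rcases Ribbon.a_corners H y n with ⟨hA, -, hQ, -⟩ | ⟨hA, -, hQ, -⟩ <;> rw [hA, hQ]
      · rw [h, Ribbon.oppositeSide_entry]
        change (Ribbon.stripData H y).a (Ribbon.cB H y n) ≤ 0 ↔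
          (Ribbon.stripData H y).a (Ribbon.cP H y n) ≤ 0
        rcases Ribbon.a_corners H y n with ⟨-, hP, -, hB⟩ | ⟨-, hP, -, hB⟩ <;> rw [hB, hP]
  apply Set.eq_singleton_iff_unique_mem.2
  constructor
  · -- `R₀` flips
    refine ⟨hR₀mem, ?_⟩
    have hmem : e ∈ Set.range (Ribbon.edge H (pres H hR₀mem)) := by
      rw [range_pres]; exact ⟨0, he0⟩
    obtain ⟨n, hn⟩ := hmem
    obtain ⟨k1, k2⟩ := key hR₀mem n hn
    by_cases hcase : s = Ribbon.entry H (pres H hR₀mem) n ∨ s = Ribbon.exit H (pres H hR₀mem) n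
    · exact (k1 hcase).1
    · exfalso
      push Not at hcase
      -- `s` lateral: across it is not in the ribbon, but `edge (st e hs) 1` is
      have hsn : s ∈ emb.sides (Ribbon.edge H (pres H hR₀mem) n) := by rw [hn]; exact hs
      have hnot := Ribbon.acrossEdge_lateral_not_mem H (pres H hR₀mem) n hsn hcase.1 hcase.2
      rw [hn, range_pres] at hnot
      exact hnot ⟨1, he1⟩
  · -- any flipping ribbon is `R₀`
    rintro R ⟨hR, hflip⟩
    by_cases hmem : e ∈ Set.range (Ribbon.edge H (pres H hR))
    · obtain ⟨n, hn⟩ := hmem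
      obtain ⟨k1, k2⟩ := key hR n hn
      by_cases hcase : s = Ribbon.entry H (pres H hR) n ∨ s = Ribbon.exit H (pres H hR) n
      · exact (k1 hcase).2
      · push Not at hcase
        exact absurd (k2 hcase) hflip
    · exfalso
      apply hflip
      rw [aR_eq H hR, aR_eq H hR]
      have hseg := FaultLine.segment_side_subset_rhombus H.iso (d := RhombicEmbedding.refDart e) hs
      rw [rhombus_refDart] at hseg
      have h1 : emb.z s.1 ∈ emb.rhombus e := hseg (left_mem_segment ℝ _ _)
      have h2 : emb.c s.2 ∈ emb.rhombus e := hseg (right_mem_segment ℝ _ _)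
      rcases Ribbon.rhombus_subset_or_subset H (pres H hR) hmem with h | h
      · exact ⟨fun _ => h h2, fun _ => h h1⟩
      · constructor
        · intro h0; have := h h1; simp only [mem_setOf_eq] at this; linarith
        · intro h0; have := h h2; simp only [mem_setOf_eq] at this; linarith

/-! ### The parity colouring -/

/-- Parity of finite sets under symmetric difference. [folklore] -/
theorem ncard_add_ncard_eq {α : Type*} {s t : Set α} (hs : s.Finite) (ht : t.Finite) :
    s.ncard + t.ncard = (symmDiff s t).ncard + 2 * (s ∩ t).ncard := by
  have h1 := Set.ncard_inter_add_ncard_sdiff_eq_ncard s t hs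
  have h2 := Set.ncard_inter_add_ncard_sdiff_eq_ncard t s ht
  have h3 : (symmDiff s t).ncard = (s \ t).ncard + (t \ s).ncard := by
    rw [Set.symmDiff_def, Set.ncard_union_eq disjoint_sdiff_sdiff hs.sdiff ht.sdiff]
  rw [Set.inter_comm t s] at h2
  omega

/-- **The parity colouring** relative to the base corner `P₀`: the parity of the number of
ribbons separating `C` from `P₀`. [cite: Bruijn1981, §4 (the parity structure of a rhombic tiling)] -/
def chi (P₀ C : ℂ) : Prop := Odd (Sep H P₀ C).ncard

/-- `χ(P₀) = 0`. [folklore] -/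
theorem not_chi_self (P₀ : ℂ) : ¬ chi H P₀ P₀ := by
  have : Sep H P₀ P₀ = ∅ := by
    rw [Set.eq_empty_iff_forall_notMem]
    rintro R ⟨-, h⟩; exact h Iff.rfl
  rw [chi, this, Set.ncard_empty]
  exact Nat.not_odd_zero

/-- **The colouring flips across every side.** [cite: Bruijn1981, §4 (each side is crossed by exactly one ribbon)] -/
theorem chi_flip {P₀ : ℂ} (hP₀ : IsCorner emb P₀) (e : G.edgeSet) {s : V × F}
    (hs : s ∈ emb.sides e) : (chi H P₀ (emb.z s.1) ↔ ¬ chi H P₀ (emb.c s.2)) := by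
  have hc1 : IsCorner emb (emb.z s.1) :=
    ⟨RhombicEmbedding.refDart e, (mem_cornerSet_iff _ _).2 (FaultLine.corner_of_mem_dartSides hs (Or.inl rfl))⟩
  have hc2 : IsCorner emb (emb.c s.2) :=
    ⟨RhombicEmbedding.refDart e, (mem_cornerSet_iff _ _).2 (FaultLine.corner_of_mem_dartSides hs (Or.inr rfl))⟩
  have hf1 := Sep_finite H hP₀ hc1
  have hf2 := Sep_finite H hP₀ hc2
  have hcard := ncard_add_ncard_eq hf1 hf2
  rw [Sep_symmDiff, flipSet_eq_singleton H e hs, Set.ncard_singleton] at hcard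
  simp only [chi]
  have hodd : Odd ((Sep H P₀ (emb.z s.1)).ncard + (Sep H P₀ (emb.c s.2)).ncard) := by
    rw [hcard]; exact ⟨(Sep H P₀ (emb.z s.1) ∩ Sep H P₀ (emb.c s.2)).ncard, by ring⟩
  constructor
  · intro h1 h2
    exact (Nat.not_even_iff_odd.2 hodd) (h1.add_odd h2)
  · intro h2
    rw [Nat.not_odd_iff_even] at h2
    by_contra h1
    rw [Nat.not_odd_iff_even] at h1
    exact (Nat.not_even_iff_odd.2 hodd) (h1.add h2)

/-! ### Propagation along the graph -/

/-- **Across a dart**: `χ(z x) = χ(z y)` and `χ(c (leftFace d)) ≠ χ(z x)` for `d = (x → y)`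
(the four sides of the rhombus of `d` each flip `χ`). [cite: Bruijn1981, §4 (the parity structure of a rhombic tiling)] -/
theorem chi_dart {P₀ : ℂ} (hP₀ : IsCorner emb P₀) (d : G.Dart) :
    (chi H P₀ (emb.z d.fst) ↔ chi H P₀ (emb.z d.snd)) ∧
      (chi H P₀ (emb.c (emb.leftFace d)) ↔ ¬ chi H P₀ (emb.z d.fst)) := by
  set e : G.edgeSet := ⟨d.edge, d.edge_mem⟩ with he
  have hsides : emb.sides e = emb.dartSides d := emb.sides_eq_dartSides H.iso rfl
  have m1 : (d.fst, emb.leftFace d) ∈ emb.sides e := by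
    rw [hsides]; exact (mem_dartSides_iff d _).2 (Or.inl rfl)
  have m2 : (d.snd, emb.leftFace d) ∈ emb.sides e := by
    rw [hsides]; exact (mem_dartSides_iff d _).2 (Or.inr (Or.inl rfl))
  have f1 := chi_flip H hP₀ e m1
  have f2 := chi_flip H hP₀ e m2
  simp only at f1 f2
  constructor
  · tauto
  · tauto

/-- `χ ∘ z` is constant on connected components. [folklore] -/
theorem chi_reachable {P₀ : ℂ} (hP₀ : IsCorner emb P₀) {x y : V} (h : G.Reachable x y) :
    (chi H P₀ (emb.z x) ↔ chi H P₀ (emb.z y)) := by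
  obtain ⟨w⟩ := h
  induction w with
  | nil => exact Iff.rfl
  | @cons a b _ hab _ ih => exact (chi_dart H hP₀ ⟨(a, b), hab⟩).1.trans ih

end Parity

/-! ### Main theorem: corner consistency -/

/-- **Corner consistency of connected rhombic tilings.** For a preconnected graph isoradially
embedded with the tiling condition and bounded angles, no vertex is drawn at the centre of a
face of a rhombus: `emb.z v ≠ emb.c (emb.leftFace d)` for every vertex `v` and dart `d` — the
corner set of the diamond graph `G^◇` is properly two-coloured into vertices of `G` and
vertices of `G*` (Grimmett–Manolescu 2014, §2.1: "`G^◇` has vertex set `V ∪ V*`", a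
*bipartite* rhombic tiling; the hypothesis `hcons` of `IsoradialDualCrossings`).
[cite: GrimmettManolescu2014Isoradial, §2.1 and §4.1 (the diamond graph G^◇ with vertex set V ∪ V*, a rhombic tiling)] -/
theorem z_ne_c_leftFace (H : PlanarTilingHyps emb ε) (v : V) (d : G.Dart) :
    emb.z v ≠ emb.c (emb.leftFace d) := by
  intro hclash
  set P₀ : ℂ := emb.z d.fst with hP₀
  have hP₀c : Parity.IsCorner emb P₀ := ⟨d, (Parity.mem_cornerSet_iff d _).2 (Or.inl rfl)⟩
  have h0 : ¬ Parity.chi H P₀ P₀ := Parity.not_chi_self H P₀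
  -- `χ(z v) = χ(P₀) = 0`
  have hv : (Parity.chi H P₀ (emb.z v) ↔ Parity.chi H P₀ P₀) :=
    Parity.chi_reachable H hP₀c (H.conn v d.fst)
  -- `χ(c (leftFace d)) = ¬ χ(P₀) = 1`
  have hf : (Parity.chi H P₀ (emb.c (emb.leftFace d)) ↔ ¬ Parity.chi H P₀ P₀) :=
    (Parity.chi_dart H hP₀c d).2
  rw [hclash] at hv
  exact iff_not_self (hv.symm.trans hf)

/-- **Corner consistency** in the form used by the planar-duality files (`hcons` of
`IsoradialDualCrossings.not_mem_embDualTBCrossing_of_mem_embRectCrossing`, `hclash` of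
`IsoradialDualityExclusion`): for preconnected `G`, isoradial `emb` with the tiling condition
and BAP(ε), `ε > 0`. [cite: GrimmettManolescu2014Isoradial, §2.1 and §4.1 (the diamond graph G^◇ with vertex set V ∪ V*, a rhombic tiling)] -/
theorem cornerConsistent (hconn : G.Preconnected) (hiso : emb.IsIsoradial)
    (hrh : emb.IsRhombicTiling) (hbap : emb.HasBoundedAngles ε) (hε : 0 < ε) :
    ∀ (v : V) (d : G.Dart), emb.z v ≠ emb.c (emb.leftFace d) :=
  fun v d => z_ne_c_leftFace ⟨hconn, hiso, hrh, hbap, hε⟩ v d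

end Literature.Probability.Percolation

end
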